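import Literature.Computability.Complexity.MonotoneClosure
import Literature.Computability.Complexity.HarnikRazApproximators
import Literature.Combinatorics.SetFamily.BiasedMeasure
import Mathlib.Data.Finset.SymmDiff
import Literature.Computability.Complexity.MatchingSunflowersProofs
import Literature.Probability.RandomGraphs.PlantedClique
import Literature.Combinatorics.SetFamily.ParkPham
import Literature.Computability.Complexity.MatchingSunflowers
import Literature.Computability.Complexity.RobustSunflowerBoundProofs
import Literature.Computability.Complexity.KWProtocolFormula
import Literature.Computability.Complexity.CircuitSizeProofs
import Literature.Barriers.PneNP.MonotoneGapPerfectMatchingProofs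
import HarnessLib

/-!
# CGRSS 2026 Theorem 1 — monotone circuits for perfect matching need `2^{n^{1/3−δ}}` gates — `CavalarEtAl2026_perfectMatching` HOLDS (re-homed proofs)

**Cavalar–Göös–Riazanov–Sofronova–Sokolov, *Monotone Circuit Complexity of Matching* (STOC 2026, arXiv:2507.16105), THEOREM 1 — the
named fact `Literature.Computability.Complexity.CavalarEtAl2026_perfectMatching` (`MatchingSunflowers.lean`) HOLDS**: for every `δ > 0` and
all large `n`, every monotone circuit computing the perfect-matching function of `K_{n,n}` has at least `2^{n^{1/3−δ}}` gates
(`2^{n^{1/3-δ}} ≤ circuitSizeOver monotoneBasis (perfectMatchingFn n)` eventually) [CavalarEtAl2026]; improves Razborov 1985 (`n^{Ω(log n)}`,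
proved in the tree).  ARCHITECTURE of the in-tree proof (kernel-checked; until now Summits-side only,
`Summits/PneNP/PneNP/Theorems/NegLimitedGapPMThm1.lean`): the GAP-ROBUST APPROXIMATION METHOD on the `p`-biased cross-cut measure — the
CKR closure calculus for weighted minterm families (`prW`, closed families, `closureW`, approximators `IsApproxW`, the scheme `schemeW` and its
gained-support / gained-infimum sums), the conditional FLIP COUPLING for biased product measures (`BiasedFlip`), the BIASED MATCHING SUNFLOWER
LEMMA `biasedMatchingSunflower_holds` (CGRSS Lemma 2 in a `p`-biased variant, from the robust sunflower theorem of the tree's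
`Literature/Combinatorics/SetFamily` and the flip coupling [CavalarKumarRossman2022]), the minterm bookkeeping (`crossMeasure`,
`SunflowerBound`, `thr`), the DEFICIENT-MASS and CROSS-DEFICIENT estimates (Karlin–Rubin-type monotone bound `sum_biasedWeight_mul_card`),
the parametric dichotomy `gapPM_dichotomy`, the exponential form `GapPerfectMatchingExp` (`gapPMExp_of`, `gapPerfectMatchingExp_holds`) and the
corollary `gapExp_implies_thm1`.  RE-HOMED into `Literature/` by the Hodge foundations lane (`lit-hodgefound`, seat p20, generation 38):
verbatim DECLARATION-LEVEL ports (the declarations needed, in dependency order) of the 13 Summits modules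
`Summits/PneNP/PneNP/Theorems/{NegLimited{MonotoneClosureW,GapPMScheme,BiasedMeasureFlip,BiasedMatchingSunflower,GapPMMinterms,DeficientMass,
GapPMParametric,GapPMQuasipolyOfExp,GapPMExp,GapPerfectMatchingQuasipoly,GapPMCorollaries},KarlinRubinMonotoneBlindCoverUpset}.lean`, namespace
`Summit.PneNP.PneNP.Theorems` re-rooted as `Literature.Computability.Complexity.CGRSS2026` (sub-namespaces `NegLimitedGapPM`, `BiasedFlip`,
`MonotoneBlind.VertexCover` kept), followed by the EXACT-name discharge `Literature.Computability.Complexity.CavalarEtAl2026_perfectMatching_holds`.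
The route's intermediate statements come as definitions WITH their proofs in the same file (`BiasedMatchingSunflower` /
`biasedMatchingSunflower_holds`, `CrossDeficient` / `crossDeficient_holds`, `DeficientMass` / `deficientMass_holds`, `GapPerfectMatchingExp` /
`gapPerfectMatchingExp_holds`) and the combinatorial gadgets with their bodies (`prW`, `IsClosedFamW`, `closureW`, `IsApproxW`, `schemeW`,
`crossGraph`, `crossInput`, `IsCrossMatchingSunflower`, `crossTarget`, `crossMeasure`, `SunflowerBound`, `thr`, `Deficient`, `posSmall`,
`posLost`, `negGain`); no unproved named fact (D-0026), no Summits import; every declaration carries a citation.  Built on the tree's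
Literature layer (`Computability/Complexity/MatchingSunflowers*`, `Combinatorics/SetFamily/RobustSunflower*`, `Barriers/PneNP/*` for
`perfectMatchingFn` / `circuitSizeOver`) and Mathlib.  The Summits originals stay in place (transitional duplication).  WHAT THIS IS NOT:
nothing about P versus NP (a monotone lower bound; the Razborov–Tardos gap between monotone and general circuits is untouched).
-/

noncomputable section

/-!
## Part 1 — port of `Summits/PneNP/PneNP/Theorems/NegLimitedMonotoneClosureW.lean` (22 declarations kept)

# Route NegLimited — the CKR closure operator for an arbitrary negative input distribution 

Cavalar–Kumar–Rossman's closure formalism (Algorithmica 84 (2022), §2.4–2.5; the tree's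
`Literature/Computability/Complexity/MonotoneClosure.lean`, namespace `CKR`, for the UNIFORM input
`prHalf`) with the uniform negative test input replaced by an ARBITRARY weight `μ : 𝒫(V) → ℝ≥0`
of total mass `1` on the supports (`prW μ E = Σ_{U : E U} μ U`). Everything in CKR §2.4–2.5 is a
union bound over the additions of the closure process, so the proofs are those of
`MonotoneClosure.lean` with `prHalf ↦ prW μ`; the measure-free parts (`Razborov.minimals`, `CKR.trim`,
`CKR.containing`) are imported, not copied. Cell record: HOME/pnp-ideate-p3/ROUND-7.md §4 (engine
design, row C1) — first piece of the registered stub `stub_gapPMExp` of item stmt-PneNP-19861.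

* `prW μ E` and its calculus (`prW_nonneg`, `prW_mono`, `prW_le_add`, `prW_not`, `prW_eq_zero`);
* `IsClosedFamW μ c ε 𝒯` — CKR Def. 2.6 w.r.t. `μ`; `closureW μ c ε 𝒮` — CKR Def. 2.8;
* `prW_not_mem_and_mem_closureW_le` — CKR Lemma 2.10: `Pr_μ[U ∉ 𝒮 ∧ U ∈ cl(𝒮)] ≤ ε·#{A : |A| ≤ c}`;
* `isClosedFamW_containing` — CKR Lemma 2.12 under the hypothesis `Pr_μ[i ∈ U] ≤ 1 - ε`;
* `exists_minimal_of_mem_of_not_mem_trim_closureW` — the containment behind CKR Lemma 2.16.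

(Verbatim declaration-level port — the declarations listed in the Part header count — of the Summits-side module of the PneNP
tree's NegLimited route; route / round / item bookkeeping in the text above is historical.)
-/

section Part1

namespace Literature.Computability.Complexity.CGRSS2026.NegLimitedGapPM

open _root_.Finset Literature.Computability.Complexity.Razborov Literature.Computability.Complexity.CKR

variable {V : Type*} [Fintype V] [DecidableEq V]

/-! ### An arbitrary negative input distribution on the supports -/

/-- `Pr_μ[E(U)]` for a random support `U ⊆ V` with weights `μ` (CKR's `𝐍` of Def. 2.2 is the case
`μ ≡ 2^{-|V|}`, `CKR.prHalf`). [cite: CavalarEtAl2026, Thm. 1 (§1; proof §3–§4) (bookkeeping)] -/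
def prW (μ : Finset V → ℝ) (E : Finset V → Prop) [DecidablePred E] : ℝ := ∑ U ∈ univ.filter E, μ U

variable {μ : Finset V → ℝ}

omit [DecidableEq V] in
/-- Monotonicity of probability. [cite: CavalarEtAl2026, Thm. 1 (§1; proof §3–§4) (bookkeeping)] -/
theorem prW_mono (hμ : ∀ U, 0 ≤ μ U) {E E' : Finset V → Prop} [DecidablePred E] [DecidablePred E']
    (h : ∀ U, E U → E' U) : prW μ E ≤ prW μ E' :=
  sum_le_sum_of_subset_of_nonneg (monotone_filter_right _ fun U _ hU => h U hU) fun U _ _ => hμ U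

/-- The union bound for two events. [cite: CavalarEtAl2026, Thm. 1 (§1; proof §3–§4) (bookkeeping)] -/
theorem prW_le_add (hμ : ∀ U, 0 ≤ μ U) {E E₁ E₂ : Finset V → Prop} [DecidablePred E]
    [DecidablePred E₁] [DecidablePred E₂] (h : ∀ U, E U → E₁ U ∨ E₂ U) :
    prW μ E ≤ prW μ E₁ + prW μ E₂ := by
  unfold prW
  have hsub : univ.filter E ⊆ univ.filter E₁ ∪ univ.filter E₂ := by
    intro U hU
    rw [mem_union, mem_filter, mem_filter]
    rcases h U (mem_filter.1 hU).2 with h' | h'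
    · exact Or.inl ⟨mem_univ _, h'⟩
    · exact Or.inr ⟨mem_univ _, h'⟩
  refine (sum_le_sum_of_subset_of_nonneg hsub fun U _ _ => hμ U).trans ?_
  rw [← sum_union_inter]
  have : 0 ≤ ∑ U ∈ univ.filter E₁ ∩ univ.filter E₂, μ U := sum_nonneg fun U _ => hμ U
  linarith

omit [DecidableEq V] in
/-- Complements: `Pr[¬ E] = 1 - Pr[E]` for weights of total mass `1`.
[cite: CavalarEtAl2026, Thm. 1 (§1; proof §3–§4) (bookkeeping)] -/
theorem prW_not (hμ1 : ∑ U, μ U = 1) (E : Finset V → Prop) [DecidablePred E] :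
    prW μ (fun U => ¬ E U) = 1 - prW μ E := by
  unfold prW
  rw [← hμ1, ← sum_filter_add_sum_filter_not univ E]
  ring

omit [DecidableEq V] in
/-- An event that never happens has probability `0`.
[cite: CavalarEtAl2026, Thm. 1 (§1; proof §3–§4) (bookkeeping)] -/
theorem prW_eq_zero {E : Finset V → Prop} [DecidablePred E] (h : ∀ U, ¬ E U) : prW μ E = 0 := by
  unfold prW
  rw [filter_eq_empty_iff.2 fun U _ => h U, sum_empty]

omit [DecidableEq V] in
/-- Events with the same extension have the same probability.
[cite: CavalarEtAl2026, Thm. 1 (§1; proof §3–§4) (bookkeeping)] -/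
theorem prW_congr {E E' : Finset V → Prop} [DecidablePred E] [DecidablePred E']
    (h : ∀ U, E U ↔ E' U) : prW μ E = prW μ E' := by
  unfold prW
  rw [filter_congr fun U _ => h U]

/-! ### Closed families and the closure operator w.r.t. `μ` -/

/-- **Closed up-sets w.r.t. `μ`** (CKR Def. 2.6 with `𝐍 ∼ μ`): for every `A` with `|A| ≤ c`,
`Pr_μ[A ∪ U ∈ 𝒯] > 1 - ε` forces `A ∈ 𝒯`. [cite: CavalarEtAl2026, Thm. 1 (§1; proof §3–§4) (bookkeeping)] -/
def IsClosedFamW (μ : Finset V → ℝ) (c : ℕ) (ε : ℝ) (𝒯 : Finset (Finset V)) : Prop :=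
  ∀ A : Finset V, #A ≤ c → 1 - ε < prW μ (fun U => A ∪ U ∈ 𝒯) → A ∈ 𝒯

open _root_.Classical in
/-- **The closure operator w.r.t. `μ`** (CKR Def. 2.8): the least `μ`-closed up-set containing `𝒮`,
as the intersection of all of them. [cite: CavalarEtAl2026, Thm. 1 (§1; proof §3–§4) (bookkeeping)] -/
noncomputable def closureW (μ : Finset V → ℝ) (c : ℕ) (ε : ℝ) (𝒮 : Finset (Finset V)) :
    Finset (Finset V) :=
  univ.filter fun A => ∀ 𝒯 : Finset (Finset V), 𝒮 ⊆ 𝒯 → IsUpperSet (𝒯 : Set (Finset V)) →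
    IsClosedFamW μ c ε 𝒯 → A ∈ 𝒯

variable {c : ℕ} {ε : ℝ}

/-- Membership in the closure. [cite: CavalarEtAl2026, Thm. 1 (§1; proof §3–§4) (bookkeeping)] -/
theorem mem_closureW {𝒮 : Finset (Finset V)} {A : Finset V} :
    A ∈ closureW μ c ε 𝒮 ↔ ∀ 𝒯 : Finset (Finset V), 𝒮 ⊆ 𝒯 → IsUpperSet (𝒯 : Set (Finset V)) →
      IsClosedFamW μ c ε 𝒯 → A ∈ 𝒯 := by
  classical
  simp [closureW]

/-- `𝒮 ⊆ cl(𝒮)`. [cite: CavalarEtAl2026, Thm. 1 (§1; proof §3–§4) (bookkeeping)] -/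
theorem subset_closureW (𝒮 : Finset (Finset V)) : 𝒮 ⊆ closureW μ c ε 𝒮 :=
  fun _ hA => mem_closureW.2 fun _ h𝒮 _ _ => h𝒮 hA

/-- The closure is an up-set. [cite: CavalarEtAl2026, Thm. 1 (§1; proof §3–§4) (bookkeeping)] -/
theorem isUpperSet_closureW (𝒮 : Finset (Finset V)) :
    IsUpperSet (closureW μ c ε 𝒮 : Set (Finset V)) := by
  intro A B hAB hA
  rw [mem_coe, mem_closureW] at hA ⊢
  exact fun 𝒯 h1 h2 h3 => h2 hAB (hA 𝒯 h1 h2 h3)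

/-- The closure is contained in every closed up-set containing `𝒮` (minimality).
[cite: CavalarEtAl2026, Thm. 1 (§1; proof §3–§4) (bookkeeping)] -/
theorem closureW_subset {𝒮 𝒯 : Finset (Finset V)} (h1 : 𝒮 ⊆ 𝒯)
    (h2 : IsUpperSet (𝒯 : Set (Finset V))) (h3 : IsClosedFamW μ c ε 𝒯) : closureW μ c ε 𝒮 ⊆ 𝒯 :=
  fun _ hA => mem_closureW.1 hA 𝒯 h1 h2 h3

/-- The closure is closed (intersections of closed up-sets are closed; CKR Rem. 2.9).
[cite: CavalarEtAl2026, Thm. 1 (§1; proof §3–§4) (bookkeeping)] -/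
theorem isClosedFamW_closureW (hμ : ∀ U, 0 ≤ μ U) (𝒮 : Finset (Finset V)) :
    IsClosedFamW μ c ε (closureW μ c ε 𝒮) := by
  intro A hA hpr
  refine mem_closureW.2 fun 𝒯 h1 h2 h3 => h3 A hA (hpr.trans_le ?_)
  exact prW_mono hμ fun U hU => closureW_subset h1 h2 h3 hU

/-- **CKR Lemma 2.10 w.r.t. `μ`, inductive form**: for an up-set `𝒯` between `𝒮` and its closure,
`Pr_μ[U ∉ 𝒯 ∧ U ∈ cl(𝒮)] ≤ ε · #{A : |A| ≤ c, A ∉ 𝒯}` — add a violating `A` at cost `< ε` and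
recurse (the measure enters only through monotonicity, the union bound and complements).
[cite: CavalarEtAl2026, Thm. 1 (§1; proof §3–§4) (bookkeeping)] -/
theorem prW_not_mem_and_mem_closureW_le_aux (hμ : ∀ U, 0 ≤ μ U) (hμ1 : ∑ U, μ U = 1)
    (hε : 0 ≤ ε) (𝒮 : Finset (Finset V)) :
    ∀ (n : ℕ) (𝒯 : Finset (Finset V)), IsUpperSet (𝒯 : Set (Finset V)) → 𝒮 ⊆ 𝒯 →
      𝒯 ⊆ closureW μ c ε 𝒮 → #(smallOut c 𝒯) ≤ n →
      prW μ (fun U => U ∉ 𝒯 ∧ U ∈ closureW μ c ε 𝒮) ≤ ε * #(smallOut c 𝒯) := by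
  intro n
  induction n with
  | zero =>
    intro 𝒯 hup h𝒮 hcl hn
    have hclosed : IsClosedFamW μ c ε 𝒯 := by
      intro A hA _
      by_contra hAT
      have : A ∈ smallOut c 𝒯 := mem_filter.2 ⟨mem_filter.2 ⟨mem_univ _, hA⟩, hAT⟩
      rw [Nat.le_zero, card_eq_zero] at hn
      rw [hn] at this
      exact absurd this (notMem_empty A)
    rw [prW_eq_zero fun U ⟨h1, h2⟩ => h1 (closureW_subset h𝒮 hup hclosed h2)]
    positivity
  | succ n ih =>
    intro 𝒯 hup h𝒮 hcl hn
    by_cases hclosed : IsClosedFamW μ c ε 𝒯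
    · rw [prW_eq_zero fun U ⟨h1, h2⟩ => h1 (closureW_subset h𝒮 hup hclosed h2)]
      positivity
    simp only [IsClosedFamW, not_forall, exists_prop] at hclosed
    obtain ⟨A, hAc, hApr, hAT⟩ := hclosed
    set 𝒯' : Finset (Finset V) := 𝒯 ∪ univ.filter fun B => A ⊆ B with h𝒯'
    have hup' : IsUpperSet (𝒯' : Set (Finset V)) := by
      intro B B' hBB' hB
      rw [mem_coe, h𝒯', mem_union] at hB ⊢
      rcases hB with hB | hB
      · exact Or.inl (hup hBB' hB)
      · exact Or.inr (mem_filter.2 ⟨mem_univ _, (mem_filter.1 hB).2.trans hBB'⟩)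
    have h𝒮' : 𝒮 ⊆ 𝒯' := h𝒮.trans subset_union_left
    have hAcl : A ∈ closureW μ c ε 𝒮 :=
      isClosedFamW_closureW hμ 𝒮 A hAc (hApr.trans_le (prW_mono hμ fun U hU => hcl hU))
    have hcl' : 𝒯' ⊆ closureW μ c ε 𝒮 := by
      refine union_subset hcl fun B hB => ?_
      exact isUpperSet_closureW 𝒮 (mem_filter.1 hB).2 hAcl
    have hsub : smallOut c 𝒯' ⊆ smallOut c 𝒯 := by
      intro B hB
      obtain ⟨hB1, hB2⟩ := mem_filter.1 hB
      exact mem_filter.2 ⟨hB1, fun h => hB2 (mem_union_left _ h)⟩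
    have hAin : A ∈ smallOut c 𝒯 := mem_filter.2 ⟨mem_filter.2 ⟨mem_univ _, hAc⟩, hAT⟩
    have hAout : A ∉ smallOut c 𝒯' := fun h =>
      (mem_filter.1 h).2 (mem_union_right _ (mem_filter.2 ⟨mem_univ _, Subset.refl A⟩))
    have hcard : #(smallOut c 𝒯') + 1 ≤ #(smallOut c 𝒯) := by
      have : smallOut c 𝒯' ⊂ smallOut c 𝒯 :=
        Finset.ssubset_iff_subset_ne.2 ⟨hsub, fun h => hAout (h ▸ hAin)⟩
      exact card_lt_card this
    have hIH := ih 𝒯' hup' h𝒮' hcl' (by omega)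
    have herr : prW μ (fun U => U ∈ 𝒯' ∧ U ∉ 𝒯) ≤ ε := by
      have h1 : prW μ (fun U => U ∈ 𝒯' ∧ U ∉ 𝒯) ≤ prW μ (fun U => ¬ (A ∪ U ∈ 𝒯)) := by
        refine prW_mono hμ fun U ⟨hU1, hU2⟩ => ?_
        rw [h𝒯', mem_union] at hU1
        rcases hU1 with hU1 | hU1
        · exact absurd hU1 hU2
        · rwa [union_eq_right.2 (mem_filter.1 hU1).2]
      rw [prW_not hμ1] at h1
      linarith
    calc prW μ (fun U => U ∉ 𝒯 ∧ U ∈ closureW μ c ε 𝒮)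
        ≤ prW μ (fun U => U ∉ 𝒯' ∧ U ∈ closureW μ c ε 𝒮) + prW μ (fun U => U ∈ 𝒯' ∧ U ∉ 𝒯) := by
          refine prW_le_add hμ fun U ⟨hU1, hU2⟩ => ?_
          by_cases hU : U ∈ 𝒯'
          · exact Or.inr ⟨hU, hU1⟩
          · exact Or.inl ⟨hU, hU2⟩
      _ ≤ ε * #(smallOut c 𝒯') + ε := add_le_add hIH herr
      _ ≤ ε * #(smallOut c 𝒯) := by
          have : (#(smallOut c 𝒯') : ℝ) + 1 ≤ #(smallOut c 𝒯) := by exact_mod_cast hcard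
          nlinarith

/-- **CKR Lemma 2.10 w.r.t. `μ`** (approximation by closure): for an up-set `𝒮` and weights `μ ≥ 0`
of total mass `1`, `Pr_μ[U ∉ 𝒮 ∧ U ∈ cl(𝒮)] ≤ ε · #{A ⊆ V : |A| ≤ c}`.
[cite: CavalarEtAl2026, Thm. 1 (§1; proof §3–§4) (bookkeeping)] -/
theorem prW_not_mem_and_mem_closureW_le (hμ : ∀ U, 0 ≤ μ U) (hμ1 : ∑ U, μ U = 1) (hε : 0 ≤ ε)
    (𝒮 : Finset (Finset V)) (h𝒮 : IsUpperSet (𝒮 : Set (Finset V))) :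
    prW μ (fun U => U ∉ 𝒮 ∧ U ∈ closureW μ c ε 𝒮)
      ≤ ε * #(univ.filter fun A : Finset V => #A ≤ c) := by
  have h := prW_not_mem_and_mem_closureW_le_aux (c := c) hμ hμ1 hε 𝒮 _ 𝒮 h𝒮 Subset.rfl
    (subset_closureW 𝒮) le_rfl
  refine h.trans (mul_le_mul_of_nonneg_left ?_ hε)
  exact_mod_cast card_le_card (filter_subset _ _)

/-! ### Input functions -/

/-- **CKR Lemma 2.12 w.r.t. `μ`** (input functions are closed): if `Pr_μ[i ∈ U] ≤ 1 - ε` then the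
up-set `containing i` of the input `x_i` is `μ`-closed.
[cite: CavalarEtAl2026, Thm. 1 (§1; proof §3–§4) (bookkeeping)] -/
theorem isClosedFamW_containing (c : ℕ) {i : V}
    (hinp : prW μ (fun U : Finset V => i ∈ U) ≤ 1 - ε) : IsClosedFamW μ c ε (containing i) := by
  intro A _ hpr
  by_contra hA
  rw [mem_containing] at hA
  have : prW μ (fun U : Finset V => A ∪ U ∈ containing i) = prW μ (fun U : Finset V => i ∈ U) :=
    prW_congr fun U => by simp [hA]
  rw [this] at hpr
  linarith

/-! ### Trimming against the `μ`-closure -/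

/-- **Containment behind CKR Lemmas 2.16/2.18, w.r.t. `μ`**: if the up-set `ℋ` has all minterms of
size `≤ c` and `h = cl_μ(ℋ)`, an input accepted by `ℋ` but rejected by `trim(h)` contains a minterm
of `h` of size in `(c/2, c]`. [cite: CavalarEtAl2026, Thm. 1 (§1; proof §3–§4) (bookkeeping)] -/
theorem exists_minimal_of_mem_of_not_mem_trim_closureW {ℋ : Finset (Finset V)}
    (hℋ : ∀ A ∈ minimals ℋ, #A ≤ c) {U : Finset V} (hU : U ∈ ℋ)
    (hUt : U ∉ trim c (closureW μ c ε ℋ)) :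
    ∃ A ∈ minimals (closureW μ c ε ℋ), c / 2 < #A ∧ #A ≤ c ∧ A ⊆ U := by
  obtain ⟨A', hA', hA'U⟩ := exists_minimal_subset hU
  obtain ⟨A, hA, hAA'⟩ := exists_minimal_subset (subset_closureW (μ := μ) (c := c) (ε := ε) ℋ
    (minimals_subset _ hA'))
  have hAc : #A ≤ c := (card_le_card hAA').trans (hℋ A' hA')
  refine ⟨A, hA, ?_, hAc, hAA'.trans hA'U⟩
  by_contra hlt
  exact hUt (mem_trim.2 ⟨A, hA, not_lt.1 hlt, hAA'.trans hA'U⟩)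

/-! ### The approximators: trimmed `μ`-closed up-sets (CKR §2.6 w.r.t. `μ`) -/

/-- **The approximators w.r.t. `μ`**: `𝒜 = {trim(𝒯) : 𝒯 a μ-closed up-set}`.
[cite: CavalarEtAl2026, Thm. 1 (§1; proof §3–§4) (bookkeeping)] -/
def IsApproxW (μ : Finset V → ℝ) (c : ℕ) (ε : ℝ) (𝒜 : Finset (Finset V)) : Prop :=
  ∃ 𝒯 : Finset (Finset V), IsUpperSet (𝒯 : Set (Finset V)) ∧ IsClosedFamW μ c ε 𝒯 ∧ 𝒜 = trim c 𝒯

/-- Approximators are up-sets. [cite: CavalarEtAl2026, Thm. 1 (§1; proof §3–§4) (bookkeeping)] -/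
theorem IsApproxW.isUpperSet {𝒜 : Finset (Finset V)} (h : IsApproxW μ c ε 𝒜) :
    IsUpperSet (𝒜 : Set (Finset V)) := by
  obtain ⟨𝒯, -, -, rfl⟩ := h
  exact isUpperSet_trim c 𝒯

/-- Approximators are trimmed: their minterms have size `≤ c/2`.
[cite: CavalarEtAl2026, Thm. 1 (§1; proof §3–§4) (bookkeeping)] -/
theorem IsApproxW.card_le_of_mem_minimals {𝒜 : Finset (Finset V)} (h : IsApproxW μ c ε 𝒜)
    {A : Finset V} (hA : A ∈ minimals 𝒜) : #A ≤ c / 2 := by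
  obtain ⟨𝒯, -, -, rfl⟩ := h
  exact (minimals_trim hA).2

/-- `trim(cl_μ(𝒮))` is an approximator. [cite: CavalarEtAl2026, Thm. 1 (§1; proof §3–§4) (bookkeeping)] -/
theorem isApproxW_trim_closureW (hμ : ∀ U, 0 ≤ μ U) (𝒮 : Finset (Finset V)) :
    IsApproxW μ c ε (trim c (closureW μ c ε 𝒮)) :=
  ⟨closureW μ c ε 𝒮, isUpperSet_closureW 𝒮, isClosedFamW_closureW hμ 𝒮, rfl⟩

/-- The minterms of `𝒜 ∨ ℬ` and of `𝒜 ∧ ℬ` of two approximators have size `≤ c`.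
[cite: CavalarEtAl2026, Thm. 1 (§1; proof §3–§4) (bookkeeping)] -/
theorem IsApproxW.card_le_of_mem_minimals_union_inter {𝒜 ℬ : Finset (Finset V)}
    (h𝒜 : IsApproxW μ c ε 𝒜) (hℬ : IsApproxW μ c ε ℬ) :
    (∀ A ∈ minimals (𝒜 ∪ ℬ), #A ≤ c) ∧ (∀ A ∈ minimals (𝒜 ∩ ℬ), #A ≤ c) := by
  constructor
  · intro A hA
    rcases minimals_union hA with h | h
    · exact (h𝒜.card_le_of_mem_minimals h).trans (Nat.div_le_self c 2)
    · exact (hℬ.card_le_of_mem_minimals h).trans (Nat.div_le_self c 2)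
  · intro A hA
    obtain ⟨M₁, hM₁, M₂, hM₂, rfl⟩ := minimals_inter h𝒜.isUpperSet hℬ.isUpperSet hA
    have h1 := h𝒜.card_le_of_mem_minimals hM₁
    have h2 := hℬ.card_le_of_mem_minimals hM₂
    calc #(M₁ ∪ M₂) ≤ #M₁ + #M₂ := card_union_le _ _
      _ ≤ c / 2 + c / 2 := Nat.add_le_add h1 h2
      _ ≤ c := by omega

end Literature.Computability.Complexity.CGRSS2026.NegLimitedGapPM

end Part1

/-!
## Part 2 — port of `Summits/PneNP/PneNP/Theorems/NegLimitedGapPMScheme.lean` (5 declarations kept)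

# Route NegLimited — the CKR approximation scheme w.r.t. an arbitrary negative distribution 

The approximators of Cavalar–Kumar–Rossman (§2.6; tree: `HarnikRazApproximators.lean`, §Scheme)
for the closure operator `closureW μ` of `NegLimitedMonotoneClosureW.lean`: `𝒜 = {trim(𝒯)}` over the
`μ`-closed up-sets, `f ⊔ g = trim(cl_μ(f ∨ g))`, `f ⊓ g = trim(cl_μ(f ∧ g))`, inputs `x_i ↦ {A : i ∈ A}`
(closed as soon as `Pr_μ[i ∈ U] ≤ 1 - ε`), packaged as an `ApproxScheme` (`schemeW`), and the
NEGATIVE per-gate error bounds for the test family "all supports `U`, weight `μ U`": an approximate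
gate gains at most `ε · #{A : |A| ≤ c}` (CKR Lemma 2.10 w.r.t. `μ`: `sum_gainedSupW_le`,
`sum_gainedInfW_le`). The positive side (perfect matchings; few MATCHING minterms via the biased
Matching Sunflower Lemma) is in `NegLimitedGapPMMinterms.lean`. Cell record:
HOME/pnp-ideate-p3/ROUND-7.md §4; part of the registered stub `stub_gapPMExp` of item stmt-PneNP-19861.

(Verbatim declaration-level port — the declarations listed in the Part header count — of the Summits-side module of the PneNP
tree's NegLimited route; route / round / item bookkeeping in the text above is historical.)
-/

section Part2

namespace Literature.Computability.Complexity.CGRSS2026.NegLimitedGapPM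

open _root_.Finset Literature.Computability.Complexity Literature.Computability.Complexity.Razborov
  Literature.Computability.Complexity.CKR
open Literature.Combinatorics.SetFamily (finsetEquivFun)

variable {V : Type*} [Fintype V] [DecidableEq V] {μ : Finset V → ℝ} {c : ℕ} {ε : ℝ}

/-- **The approximation scheme of CKR w.r.t. `μ`**: approximators `IsApproxW μ c ε`, semantics "the
support of the input lies in the up-set", `f ⊔ g = trim(cl_μ(f ∨ g))`, `f ⊓ g = trim(cl_μ(f ∧ g))`,
inputs `x_i ↦ containing i` (closed when `Pr_μ[i ∈ U] ≤ 1 - ε`, trimmed for `c ≥ 2`).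
[cite: CavalarEtAl2026, Thm. 1 (§1; proof §3–§4) (bookkeeping)] -/
noncomputable def schemeW (μ : Finset V → ℝ) (c : ℕ) (ε : ℝ) (hμ : ∀ U, 0 ≤ μ U) (hc : 2 ≤ c)
    (hinp : ∀ i : V, prW μ (fun U : Finset V => i ∈ U) ≤ 1 - ε) :
    ApproxScheme V (Finset (Finset V)) where
  ok := IsApproxW μ c ε
  val 𝒜 x := decide (finsetEquivFun.symm x ∈ 𝒜)
  sup 𝒜 ℬ := trim c (closureW μ c ε (𝒜 ∪ ℬ))
  inf 𝒜 ℬ := trim c (closureW μ c ε (𝒜 ∩ ℬ))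
  inp i := containing i
  ok_inp i := ⟨containing i, isUpperSet_containing i, isClosedFamW_containing c (hinp i),
    (trim_containing hc i).symm⟩
  ok_sup 𝒜 ℬ _ _ := isApproxW_trim_closureW hμ _
  ok_inf 𝒜 ℬ _ _ := isApproxW_trim_closureW hμ _
  val_inp i x := by simp

/-- The semantics of the scheme on an input given by its support.
[cite: CavalarEtAl2026, Thm. 1 (§1; proof §3–§4) (bookkeeping)] -/
@[simp] theorem schemeW_val_finsetEquivFun (hμ : ∀ U, 0 ≤ μ U) (hc : 2 ≤ c)
    (hinp : ∀ i : V, prW μ (fun U : Finset V => i ∈ U) ≤ 1 - ε) (𝒜 : Finset (Finset V))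
    (U : Finset V) : (schemeW μ c ε hμ hc hinp).val 𝒜 (finsetEquivFun U) = decide (U ∈ 𝒜) := by
  simp [schemeW]

/-! ### Errors on the negative test inputs (CKR Lemma 2.10 per gate, w.r.t. `μ`) -/

/-- **An approximate OR gains little negative weight**: the supports rejected by `𝒜 ∨ ℬ` but accepted
by `𝒜 ⊔ ℬ = trim(cl_μ(𝒜 ∪ ℬ))` have `μ`-mass `≤ ε · #{A : |A| ≤ c}` (negative test family = all
supports `U`, input `finsetEquivFun U`, weight `μ U`).
[cite: CavalarEtAl2026, Thm. 1 (§1; proof §3–§4) (bookkeeping)] -/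
theorem sum_gainedSupW_le (hμ : ∀ U, 0 ≤ μ U) (hμ1 : ∑ U, μ U = 1) (hc : 2 ≤ c)
    (hinp : ∀ i : V, prW μ (fun U : Finset V => i ∈ U) ≤ 1 - ε) (hε0 : 0 ≤ ε)
    {𝒜 ℬ : Finset (Finset V)} (h𝒜 : IsApproxW μ c ε 𝒜) (hℬ : IsApproxW μ c ε ℬ) :
    ∑ U ∈ (schemeW μ c ε hμ hc hinp).gainedSup univ finsetEquivFun 𝒜 ℬ, μ U
      ≤ ε * #(univ.filter fun A : Finset V => #A ≤ c) := by
  have hup : IsUpperSet ((𝒜 ∪ ℬ : Finset (Finset V)) : Set (Finset V)) := by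
    rw [coe_union]; exact h𝒜.isUpperSet.union hℬ.isUpperSet
  refine le_trans ?_ (prW_not_mem_and_mem_closureW_le hμ hμ1 hε0 (𝒜 ∪ ℬ) hup)
  unfold prW
  refine sum_le_sum_of_subset_of_nonneg (fun U hU => ?_) fun U _ _ => hμ U
  rw [ApproxScheme.gainedSup, mem_filter] at hU
  obtain ⟨-, hU⟩ := hU
  simp only [schemeW_val_finsetEquivFun, Bool.or_eq_false_iff, decide_eq_false_iff_not,
    decide_eq_true_eq] at hU
  obtain ⟨⟨h1, h2⟩, h3⟩ := hU
  refine mem_filter.2 ⟨mem_univ _, fun h => ?_, trim_subset (isUpperSet_closureW _) h3⟩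
  rcases mem_union.1 h with h | h
  · exact h1 h
  · exact h2 h

/-- **An approximate AND gains little negative weight** (CKR Lemma 2.10 w.r.t. `μ`).
[cite: CavalarEtAl2026, Thm. 1 (§1; proof §3–§4) (bookkeeping)] -/
theorem sum_gainedInfW_le (hμ : ∀ U, 0 ≤ μ U) (hμ1 : ∑ U, μ U = 1) (hc : 2 ≤ c)
    (hinp : ∀ i : V, prW μ (fun U : Finset V => i ∈ U) ≤ 1 - ε) (hε0 : 0 ≤ ε)
    {𝒜 ℬ : Finset (Finset V)} (h𝒜 : IsApproxW μ c ε 𝒜) (hℬ : IsApproxW μ c ε ℬ) :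
    ∑ U ∈ (schemeW μ c ε hμ hc hinp).gainedInf univ finsetEquivFun 𝒜 ℬ, μ U
      ≤ ε * #(univ.filter fun A : Finset V => #A ≤ c) := by
  have hup : IsUpperSet ((𝒜 ∩ ℬ : Finset (Finset V)) : Set (Finset V)) := by
    rw [coe_inter]; exact h𝒜.isUpperSet.inter hℬ.isUpperSet
  refine le_trans ?_ (prW_not_mem_and_mem_closureW_le hμ hμ1 hε0 (𝒜 ∩ ℬ) hup)
  unfold prW
  refine sum_le_sum_of_subset_of_nonneg (fun U hU => ?_) fun U _ _ => hμ U
  rw [ApproxScheme.gainedInf, mem_filter] at hU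
  obtain ⟨-, hU⟩ := hU
  simp only [schemeW_val_finsetEquivFun, Bool.and_eq_false_iff, decide_eq_false_iff_not,
    decide_eq_true_eq] at hU
  obtain ⟨h12, h3⟩ := hU
  refine mem_filter.2 ⟨mem_univ _, fun h => ?_, trim_subset (isUpperSet_closureW _) h3⟩
  rcases h12 with h' | h'
  · exact h' (mem_inter.1 h).1
  · exact h' (mem_inter.1 h).2

/-- **The approximation method run with `schemeW`** (bookkeeping form of
`ApproxScheme.exists_approx_circuit` for this scheme): given per-gate POSITIVE error bounds `δP` for a
weighted positive test family `(P, ptP, wP)`, every monotone circuit `C` has an approximator `𝒜` and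
exceptional sets with `wP(BadP) ≤ size · δP`, `μ(BadN) ≤ size · ε · #{A : |A| ≤ c}` such that off
them `C = 1 ⇒ U ∈ 𝒜` on positive and `U ∈ 𝒜 ⇒ C(U) = 1` on negative test inputs.
[cite: CavalarEtAl2026, Thm. 1 (§1; proof §3–§4) (bookkeeping)] -/
theorem exists_approxW {σ : Type*} [DecidableEq σ] (hμ : ∀ U, 0 ≤ μ U) (hμ1 : ∑ U, μ U = 1)
    (hc : 2 ≤ c) (hinp : ∀ i : V, prW μ (fun U : Finset V => i ∈ U) ≤ 1 - ε) (hε0 : 0 ≤ ε)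
    (P : Finset σ) (ptP : σ → V → Bool) (wP : σ → ℝ) (hwP : ∀ s, 0 ≤ wP s) (δP : ℝ)
    (hsupP : ∀ 𝒜 ℬ, IsApproxW μ c ε 𝒜 → IsApproxW μ c ε ℬ →
      ∑ s ∈ (schemeW μ c ε hμ hc hinp).lostSup P ptP 𝒜 ℬ, wP s ≤ δP)
    (hinfP : ∀ 𝒜 ℬ, IsApproxW μ c ε 𝒜 → IsApproxW μ c ε ℬ →
      ∑ s ∈ (schemeW μ c ε hμ hc hinp).lostInf P ptP 𝒜 ℬ, wP s ≤ δP)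
    (C : Circuit V) (hC : C.IsOver monotoneBasis) :
    ∃ (𝒜 : Finset (Finset V)) (BadP : Finset σ) (BadN : Finset (Finset V)), IsApproxW μ c ε 𝒜 ∧
      ∑ s ∈ BadP, wP s ≤ C.size * δP ∧
      ∑ U ∈ BadN, μ U ≤ C.size * (ε * #(univ.filter fun A : Finset V => #A ≤ c)) ∧
      (∀ s ∈ P, s ∉ BadP → C.eval (ptP s) = true → finsetEquivFun.symm (ptP s) ∈ 𝒜) ∧
      (∀ U : Finset V, U ∉ BadN → U ∈ 𝒜 → C.eval (finsetEquivFun U) = true) := by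
  classical
  haveI : Inhabited (Finset (Finset V)) := ⟨∅⟩
  obtain ⟨𝒜, BadP, BadN, hok, hcP, hcN, hpos, hneg⟩ :=
    (schemeW μ c ε hμ hc hinp).exists_approx_circuit P ptP wP univ finsetEquivFun μ hwP hμ δP
      (ε * #(univ.filter fun A : Finset V => #A ≤ c)) hsupP hinfP
      (fun a b ha hb => sum_gainedSupW_le hμ hμ1 hc hinp hε0 ha hb)
      (fun a b ha hb => sum_gainedInfW_le hμ hμ1 hc hinp hε0 ha hb) C hC (f := C.eval) (fun _ => rfl)
  refine ⟨𝒜, BadP, BadN, hok, hcP, hcN, fun s hs hsB hCs => ?_, fun U hUB hU𝒜 => ?_⟩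
  · have := hpos s hs hsB hCs
    simpa [schemeW] using this
  · have h := hneg U (mem_univ _) hUB
    simp only [schemeW_val_finsetEquivFun, decide_eq_true_eq] at h
    exact h hU𝒜

end Literature.Computability.Complexity.CGRSS2026.NegLimitedGapPM

end Part2

/-!
## Part 3 — port of `Summits/PneNP/PneNP/Theorems/NegLimitedBiasedMeasureFlip.lean` (8 declarations kept)

# Route NegLimited — flip couplings for the `p`-biased measure, `p ≤ 1/2` 

A supplement to `Literature/Combinatorics/SetFamily/BiasedMeasure.lean` (the `p`-biased product measure `μ_p` on the subsets of a
finite set, as finite sums of `biasedWeight p W`). For `p ≤ 1/2` a coordinate is at least as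
likely to be absent as present, so FLIPPING coordinates can only help an up-closed event; the
point of this file is that this remains true when the set of flipped coordinates is chosen as a
function of other, unflipped ("revealed") coordinates:

* `biasedWeight_insert_le` — `μ_p(W ∪ {x}) ≤ μ_p(W)` for `x ∉ W`, `0 ≤ p ≤ 1/2`;
* `sum_univ_eq_sum_filter_notMem_add` — `∑_W f(W) = ∑_{W ∌ x} (f(W) + f(W ∪ {x}))`;
* `sum_biasedWeight_filter_le_flip` — one conditional flip: if `F` is monotone in the
  coordinate `x` and the condition `c` does not depend on `x`, then
  `Pr_p[F] ≤ Pr_p[W ↦ if c W then F(W ∆ {x}) else F(W)]`;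
* `sum_biasedWeight_filter_le_symmDiff` — the conditional multi-flip coupling: for disjoint
  `R`, `N`, a flip set `φ(W) ⊆ N` depending only on `W ∩ R`, and an event `E` up-closed in the
  `N`-coordinates, `Pr_p[E(W)] ≤ Pr_p[E(W ∆ φ(W))]`.

Equivalently: conditionally on the revealed coordinates, the flipped coordinates are independent
with biases `1 - p ≥ p`, and an up-closed event is more likely under a product measure with
larger biases (the heterogeneous form of the monotone coupling
`sum_biasedWeight_mono_of_monotone`); the coordinate-by-coordinate proof given here avoids
product measures with non-constant biases altogether. Consumed by the biased Matching Sunflower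
Lemma R7-B (`NegLimitedMatchingSunflowersBiased.lean`), where it replaces the planned
`HeteroDomination` input (cell record: HOME/pnp-ideate-p3/ROUND-7.md §4 row A/B).

## References

Standard material (monotone couplings of product measures), e.g. S. Janson, T. Łuczak,
A. Ruciński, *Random Graphs* (2000), §1.1; G. Grimmett, *Percolation* (1999), §2.1–2.2
(increasing events, coupling of product measures). [folklore]

(Verbatim declaration-level port — the declarations listed in the Part header count — of the Summits-side module of the PneNP
tree's NegLimited route; route / round / item bookkeeping in the text above is historical.)
-/

section Part3

namespace Literature.Computability.Complexity.CGRSS2026.BiasedFlip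

open _root_.Finset Literature.Combinatorics.SetFamily

variable {α : Type*} [Fintype α] [DecidableEq α]

/-! ### Flip couplings for the biased measure with `p ≤ 1/2` -/

/-- Adding a point to a set does not increase its `μ_p`-weight when `p ≤ 1/2`
(`μ_p(W ∪ {x}) / μ_p(W) = p/(1-p) ≤ 1`). [cite: CavalarEtAl2026, Thm. 1 (§1; proof §3–§4) (bookkeeping)] -/
theorem biasedWeight_insert_le {p : ℝ} (hp0 : 0 ≤ p) (hp : p ≤ 1 / 2) {W : Finset α} {x : α}
    (hx : x ∉ W) : biasedWeight p (insert x W) ≤ biasedWeight p W := by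
  unfold biasedWeight
  have hcard : #(insert x W) = #W + 1 := card_insert_of_notMem hx
  have hle : #W + 1 ≤ Fintype.card α := by
    rw [← hcard]; exact card_le_univ _
  rw [hcard]
  obtain ⟨d, hd⟩ : ∃ d, Fintype.card α - #W = d + 1 := ⟨Fintype.card α - #W - 1, by omega⟩
  rw [show Fintype.card α - (#W + 1) = d by omega, hd, pow_succ, pow_succ]
  have h1 : p ≤ 1 - p := by linarith
  have hk : 0 ≤ p ^ #W := pow_nonneg hp0 _
  have hd0 : 0 ≤ (1 - p) ^ d := pow_nonneg (by linarith) _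
  calc p ^ #W * p * (1 - p) ^ d = p ^ #W * (1 - p) ^ d * p := by ring
    _ ≤ p ^ #W * (1 - p) ^ d * (1 - p) := mul_le_mul_of_nonneg_left h1 (mul_nonneg hk hd0)
    _ = p ^ #W * ((1 - p) ^ d * (1 - p)) := by ring

/-- Splitting a sum over all subsets according to the membership of a fixed point `x`: the
subsets containing `x` are the sets `W ∪ {x}`, `x ∉ W`. [cite: CavalarEtAl2026, Thm. 1 (§1; proof §3–§4) (bookkeeping)] -/
theorem sum_univ_eq_sum_filter_notMem_add (x : α) (f : Finset α → ℝ) :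
    ∑ W, f W = ∑ W ∈ univ.filter (fun W => x ∉ W), (f W + f (insert x W)) := by
  rw [sum_add_distrib, ← sum_filter_add_sum_filter_not univ (fun W : Finset α => x ∉ W)]
  congr 1
  refine sum_nbij' (fun W => W.erase x) (fun W => insert x W) ?_ ?_ ?_ ?_ ?_
  · intro W hW
    simp only [mem_filter, mem_univ, true_and] at hW ⊢
    exact notMem_erase x W
  · intro W hW
    simp only [mem_filter, mem_univ, true_and, not_not] at hW ⊢
    exact mem_insert_self x W
  · intro W hW
    simp only [mem_filter, mem_univ, true_and, not_not] at hW
    exact insert_erase hW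
  · intro W hW
    simp only [mem_filter, mem_univ, true_and] at hW
    exact erase_insert hW
  · intro W hW
    simp only [mem_filter, mem_univ, true_and, not_not] at hW
    simp only [insert_erase hW]

omit [Fintype α] in
/-- `W ∆ {x} = W ∪ {x}` for `x ∉ W`. [cite: CavalarEtAl2026, Thm. 1 (§1; proof §3–§4) (bookkeeping)] -/
theorem symmDiff_singleton_eq_insert {W : Finset α} {x : α} (hx : x ∉ W) :
    symmDiff W {x} = insert x W := by
  ext y
  rw [mem_symmDiff, mem_insert, mem_singleton]
  by_cases hy : y = x
  · subst hy; simp [hx]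
  · simp [hy]

omit [Fintype α] in
/-- `(W ∪ {x}) ∆ {x} = W` for `x ∉ W`. [cite: CavalarEtAl2026, Thm. 1 (§1; proof §3–§4) (bookkeeping)] -/
theorem symmDiff_insert_singleton {W : Finset α} {x : α} (hx : x ∉ W) :
    symmDiff (insert x W) {x} = W := by
  ext y
  rw [mem_symmDiff, mem_insert, mem_singleton]
  by_cases hy : y = x
  · subst hy; simp [hx]
  · simp [hy]

/-- **One conditional flip.** For `0 ≤ p ≤ 1/2`, an event `F` that is monotone in the coordinate
`x`, and a condition `c` that does not depend on the coordinate `x`, flipping the coordinate `x`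
on the sets satisfying `c` does not decrease the `μ_p`-probability:
`Pr_p[F] ≤ Pr_p[W ↦ F(W ∆ {x})  if c W, else F W]` (pair `W ∌ x` with `W ∪ {x}` and use
`μ_p(W ∪ {x}) ≤ μ_p(W)`). [cite: CavalarEtAl2026, Thm. 1 (§1; proof §3–§4) (bookkeeping)] -/
theorem sum_biasedWeight_filter_le_flip {p : ℝ} (hp0 : 0 ≤ p) (hp : p ≤ 1 / 2) (x : α)
    (c F : Finset α → Prop) [DecidablePred c] [DecidablePred F]
    (hc : ∀ W, x ∉ W → (c W ↔ c (insert x W)))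
    (hF : ∀ W, x ∉ W → F W → F (insert x W)) :
    ∑ W ∈ univ.filter F, biasedWeight p W ≤
      ∑ W ∈ univ.filter (fun W => if c W then F (symmDiff W {x}) else F W), biasedWeight p W := by
  rw [sum_filter, sum_filter, sum_univ_eq_sum_filter_notMem_add x,
    sum_univ_eq_sum_filter_notMem_add x]
  refine sum_le_sum fun W hW => ?_
  have hx : x ∉ W := (mem_filter.1 hW).2
  have hwt := biasedWeight_insert_le hp0 hp hx
  have hw0 : 0 ≤ biasedWeight p (insert x W) :=
    biasedWeight_nonneg hp0 (by linarith) _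
  by_cases hcW : c W
  · have hcW' : c (insert x W) := (hc W hx).1 hcW
    simp only [if_pos hcW, if_pos hcW', symmDiff_singleton_eq_insert hx,
      symmDiff_insert_singleton hx]
    by_cases h1 : F W
    · have h2 := hF W hx h1
      simp [h1, h2]
    · by_cases h2 : F (insert x W)
      · simp only [h1, h2, if_false, if_true, zero_add, add_zero]; exact hwt
      · simp [h1, h2]
  · have hcW' : ¬ c (insert x W) := fun h => hcW ((hc W hx).2 h)
    simp only [if_neg hcW, if_neg hcW']
    exact le_rfl

omit [Fintype α] in
/-- `(W ∪ {x}) ∆ S = (W ∆ S) ∪ {x}` for `x ∉ S`. [cite: CavalarEtAl2026, Thm. 1 (§1; proof §3–§4) (bookkeeping)] -/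
theorem symmDiff_insert_left_of_notMem {W S : Finset α} {x : α} (hx : x ∉ S) :
    symmDiff (insert x W) S = insert x (symmDiff W S) := by
  ext y
  rw [mem_symmDiff, mem_insert, mem_insert, mem_symmDiff]
  by_cases hy : y = x
  · subst hy; simp [hx]
  · simp [hy]

omit [Fintype α] in
/-- `(W ∆ {x}) ∆ S = W ∆ (S ∪ {x})` for `x ∉ S`. [cite: CavalarEtAl2026, Thm. 1 (§1; proof §3–§4) (bookkeeping)] -/
theorem symmDiff_singleton_symmDiff_eq {W S : Finset α} {x : α} (hx : x ∉ S) :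
    symmDiff (symmDiff W {x}) S = symmDiff W (insert x S) := by
  rw [symmDiff_assoc]
  congr 1
  ext y
  rw [mem_symmDiff, mem_insert, mem_singleton]
  by_cases hy : y = x
  · subst hy; simp [hx]
  · simp [hy]

/-- **Conditional multi-flip coupling.** Let `0 ≤ p ≤ 1/2`, let `R` ("revealed") and `N` be
disjoint sets of coordinates, let `φ W ⊆ N` be a set of coordinates to flip that depends only on
`W ∩ R`, and let `E` be an event that is up-closed in the `N`-coordinates. Then
`Pr_{W ∼ μ_p}[E(W)] ≤ Pr_{W ∼ μ_p}[E(W ∆ φ(W))]`: conditionally on `W ∩ R` the flipped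
coordinates are independent with biases `1 - p ≥ p`, under which an up-closed event is at least
as likely (proved by flipping one coordinate at a time, `sum_biasedWeight_filter_le_flip`).
[cite: CavalarEtAl2026, Thm. 1 (§1; proof §3–§4) (bookkeeping)] -/
theorem sum_biasedWeight_filter_le_symmDiff {p : ℝ} (hp0 : 0 ≤ p) (hp : p ≤ 1 / 2)
    (R N : Finset α) (hRN : Disjoint R N) (φ : Finset α → Finset α)
    (hφN : ∀ W, φ W ⊆ N) (hφR : ∀ W, φ W = φ (W ∩ R))
    (E : Finset α → Prop) [DecidablePred E] (hE : ∀ x ∈ N, ∀ W, E W → E (insert x W)) :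
    ∑ W ∈ univ.filter E, biasedWeight p W ≤
      ∑ W ∈ univ.filter (fun W => E (symmDiff W (φ W))), biasedWeight p W := by
  classical
  induction N using Finset.induction_on generalizing φ E with
  | empty =>
    have h0 : ∀ W, φ W = ∅ := fun W => subset_empty.1 (hφN W)
    refine le_of_eq (sum_congr ?_ fun _ _ => rfl)
    ext W
    simp only [mem_filter, mem_univ, true_and, h0 W]
    rw [show symmDiff W (∅ : Finset α) = W from symmDiff_bot W]
  | insert x N' hxN' ih =>
    have hxR : x ∉ R := fun h => disjoint_left.1 hRN h (mem_insert_self x N')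
    have hRN' : Disjoint R N' := Disjoint.mono_right (subset_insert x N') hRN
    -- first flip the coordinates of `N'`
    set φ' : Finset α → Finset α := fun W => (φ W).erase x with hφ'
    have hφ'N' : ∀ W, φ' W ⊆ N' := fun W y hy => by
      have hy' := mem_erase.1 hy
      have := hφN W hy'.2
      rcases mem_insert.1 this with h | h
      · exact absurd h hy'.1
      · exact h
    have hφ'R : ∀ W, φ' W = φ' (W ∩ R) := fun W => by
      simp only [hφ']; rw [← hφR W]
    have hxφ' : ∀ W, x ∉ φ' W := fun W => notMem_erase x _
    have hE' : ∀ y ∈ N', ∀ W, E W → E (insert y W) := fun y hy => hE y (mem_insert_of_mem hy)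
    have step1 := ih hRN' φ' hφ'N' hφ'R E hE'
    -- then flip `x` where `x ∈ φ W`
    set F : Finset α → Prop := fun W => E (symmDiff W (φ' W)) with hFdef
    have hφ'ins : ∀ W, φ' (insert x W) = φ' W := fun W => by
      rw [hφ'R, insert_inter_of_notMem hxR, ← hφ'R]
    have hφins : ∀ W, φ (insert x W) = φ W := fun W => by
      rw [hφR, insert_inter_of_notMem hxR, ← hφR]
    have hc : ∀ W, x ∉ W → (x ∈ φ W ↔ x ∈ φ (insert x W)) := fun W _ => by rw [hφins]
    have hF : ∀ W, x ∉ W → F W → F (insert x W) := fun W _ hFW => by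
      simp only [hFdef] at hFW ⊢
      rw [hφ'ins, symmDiff_insert_left_of_notMem (hxφ' W)]
      exact hE x (mem_insert_self x N') _ hFW
    have step2 := sum_biasedWeight_filter_le_flip hp0 hp x (fun W => x ∈ φ W) F hc hF
    refine step1.trans (step2.trans (le_of_eq (sum_congr ?_ fun _ _ => rfl)))
    ext W
    simp only [mem_filter, mem_univ, true_and, hFdef]
    by_cases hxW : x ∈ φ W
    · rw [if_pos hxW]
      have h1 : φ' (symmDiff W {x}) = φ' W := by
        rw [hφ'R (symmDiff W {x}), hφ'R W]
        congr 1
        ext y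
        rw [mem_inter, mem_inter, mem_symmDiff, mem_singleton]
        by_cases hy : y = x
        · subst hy; simp [hxR]
        · simp [hy]
      rw [h1, symmDiff_singleton_symmDiff_eq (hxφ' W)]
      simp only [hφ', insert_erase hxW]
    · rw [if_neg hxW]
      simp only [hφ', erase_eq_of_notMem hxW]

end Literature.Computability.Complexity.CGRSS2026.BiasedFlip

end Part3

/-!
## Part 4 — port of `Summits/PneNP/PneNP/Theorems/NegLimitedBiasedMatchingSunflower.lean` (11 declarations kept)

# Route NegLimited — R7-B: the Matching Sunflower Lemma for the biased cross-cut measure 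

The Matching Sunflower Lemma of Cavalar–Göös–Riazanov–Sofronova–Sokolov (CGRSS, arXiv:2507.16105,
Lemma 2; proved in the tree for the printed odd-cut distribution, `MatchingSunflowersProofs.lean`)
for the **`p`-biased cross-cut measure**: a random vertex set `W ⊆ U ⊔ V` of `K_{m,m}`, each
vertex independently with probability `p ≤ 1/2` (`Literature.Combinatorics.SetFamily.biasedWeight`),
and the negative test graph `crossGraph W` = the edges with exactly one endpoint in `W` (matching
number `≤ |W|`, so far from a perfect matching at small `p`, which odd-cut graphs are not). NOT
IN PRINT as stated (hence under `Summits/`): it is R7-B of the cell pnp-ideate ,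
the one new lemma of the work-bound rung towards T5⁺ `GapPerfectMatchingExp` and item
stmt-PneNP-19861; this file discharges the registered stub `stub_biasedMatchingSunflower` of the
skeleton line `r7-crosscut` (HOME/pnp-ideate-p3/Skeleton-R7-crosscut.lean, sha 0079776e761d5a21)
in the shared namespace `Summit.PneNP.PneNP.Theorems.NegLimitedGapPM` (definitions verbatim from
HOME/pnp-ideate-p3/turnkey-R8/NegLimitedGapPMDefs.lean).

* `crossGraph W` (input form `crossInput W`), `IsCrossMatchingSunflower p ε 𝓕` —
  `|𝓕| ≥ 2 ∧ Pr_{W ∼ μ_p}[∃ M ∈ 𝓕, M ∖ ⋂𝓕 ⊆ crossGraph W] > 1 - ε`;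
* `BiasedMatchingSunflower` — a universal `c₀ > 0` such that for `ℓ ≥ 1`, `0 < p ≤ 1/2`,
  `0 < ε ≤ 1/2`, every family of `ℓ`-matchings with `≥ (c₀ ℓ log²(ℓ/ε) / p²)^ℓ` members contains
  such a sunflower; `biasedMatchingSunflower_holds` — its proof (`c₀ = 12 B²`, `B = 2000`);
  `stub_biasedMatchingSunflower` — the same, under the registered stub name.

**Proof.** CGRSS §2 verbatim up to Claim 1, at bias `p`: a labelling consistent with many
members (`PerfectMatching.exists_labelling`), blocky members determined by their endpoint sets
(`PerfectMatching.Consistent.eq_of_everts_eq`), the robust sunflower theorem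
(`Literature.Combinatorics.SetFamily.robust_sunflower_spreadConst`) at `(p, ε)` for the
`2ℓ`-uniform vertex family. Claim 1 is replaced by TARGETS (`crossTarget`): given the trace of
`W` on the solo core vertices `K₁`, every non-core vertex has a target side — opposite to its solo
core partner if its label has one, else "in" for left and "out" for right vertices — such that a
member all of whose non-core endpoints are on target is a cross member (`cross_of_crossTarget`,
the three cases of CGRSS Claim 1 via `mem_core_of_endpoints` / `eq_endpoint_of_label`); and the
probability that some member of the vertex sunflower has all its non-core vertices on target is
at least its robustness `> 1 - ε`, by the conditional flip coupling
`BiasedFlip.sum_biasedWeight_filter_le_symmDiff` of `NegLimitedBiasedMeasureFlip.lean` (reveal the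
core, flip the non-core vertices whose target is "out"; uses `p ≤ 1/2`). No parity conditioning,
so `ε` is not halved. References: CGRSS, STOC 2026 / arXiv:2507.16105 §2 [CavalarEtAl2026];
Cavalar–Kumar–Rossman, Algorithmica 84 (2022) Thm. 1.3 [CavalarKumarRossman2022].

(Verbatim declaration-level port — the declarations listed in the Part header count — of the Summits-side module of the PneNP
tree's NegLimited route; route / round / item bookkeeping in the text above is historical.)
-/

section Part4

namespace Literature.Computability.Complexity.CGRSS2026.NegLimitedGapPM

open _root_.Finset Literature.Combinatorics Literature.Computability.Complexity
  Literature.Computability.Complexity.PerfectMatching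
open Literature.Combinatorics.SetFamily (biasedWeight)

variable {m : ℕ}

/-! ### The cross-cut graph and cross matching sunflowers -/

/-- The **cross-cut graph** of a vertex set `W ⊆ U ⊔ V`: the edges of `K_{m,m}` with exactly one
endpoint in `W` (the union of the two bicliques `(U ∩ W) × (V ∖ W)` and `(U ∖ W) × (V ∩ W)`; its
matching number is at most `|W|`); cf. the cut graphs `colorGraph` of CGRSS Def. 1 (arXiv:2507.16105
§1.1), with the right side complemented. [cite: CavalarEtAl2026, §2, Claim 1, variant] -/
def crossGraph (W : Finset (Vtx m)) : Finset (Edge m) :=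
  univ.filter fun e => ¬ ((Sum.inl e.1 ∈ W) ↔ (Sum.inr e.2 ∈ W))

/-- Membership in the cross-cut graph. [cite: CavalarEtAl2026, §2, Claim 1, variant] -/
@[simp] theorem mem_crossGraph {W : Finset (Vtx m)} {e : Edge m} :
    e ∈ crossGraph W ↔ ¬ ((Sum.inl e.1 ∈ W) ↔ (Sum.inr e.2 ∈ W)) := by
  simp [crossGraph]

/-- The cross-cut graph as an input `K_{m,m} → {0,1}`. [cite: CavalarEtAl2026, §2, Claim 1, variant] -/
def crossInput (W : Finset (Vtx m)) : Edge m → Bool := fun e => decide (e ∈ crossGraph W)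

/-- An **`ε`-matching sunflower for the `p`-biased cross-cut measure**: a family `𝓕` with
`|𝓕| ≥ 2` and `Pr_{W ∼ μ_p}[∃ M ∈ 𝓕, M ∖ ⋂𝓕 ⊆ crossGraph W] > 1 - ε` — CGRSS's `ε`-matching
sunflower with the odd-cut distribution replaced by the `p`-biased product measure on the `2m`
vertices and cut graphs by cross-cut graphs (cf. CGRSS arXiv:2507.16105 §1.1, display before Lemma 2).
[cite: CavalarEtAl2026, §2, Claim 1, variant] -/
def IsCrossMatchingSunflower (p ε : ℝ) (𝓕 : Finset (Finset (Edge m))) : Prop :=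
  2 ≤ #𝓕 ∧
    1 - ε < ∑ W ∈ univ.filter (fun W : Finset (Vtx m) => ∃ M ∈ 𝓕, M \ core 𝓕 ⊆ crossGraph W),
      biasedWeight p W

section BiasedClaim

variable {ℓ : ℕ} {b : Vtx m → Fin ℓ} {𝓕' : Finset (Finset (Edge m))}
  (h𝓕' : ∀ M ∈ 𝓕', IsMatching M ∧ Consistent b M)

variable (b 𝓕') in
/-- The **target** of a vertex `v` given the set `W` (through its trace on the solo core
vertices `K₁ = soloCore`): if some solo core vertex `w` carries the label of `v`, the target of
`v` is the side of the cut opposite to `w` (`true` = "in `W`" iff `w ∉ W`); otherwise left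
vertices have target "in `W`" and right vertices "not in `W`". (Replaces the recolouring
pattern `x^α` of CGRSS §2, proof of Claim 1, for the cross-cut measure.)
[cite: CavalarEtAl2026, §2, Claim 1, variant] -/
def crossTarget (W : Finset (Vtx m)) (v : Vtx m) : Bool :=
  if (∃ w ∈ soloCore b 𝓕', b w = b v) then decide (∃ w ∈ soloCore b 𝓕', b w = b v ∧ w ∉ W)
  else v.isLeft

/-- Next to a solo core vertex `v'` the target is the side opposite to `v'`. [folklore] -/
private theorem crossTarget_eq_not {W : Finset (Vtx m)} {v v' : Vtx m} (hv' : v' ∈ soloCore b 𝓕')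
    (h : b v = b v') : crossTarget b 𝓕' W v = !decide (v' ∈ W) := by
  unfold crossTarget
  have hex : ∃ w ∈ soloCore b 𝓕', b w = b v := ⟨v', hv', h.symm⟩
  rw [if_pos hex]
  have huniq : ∀ w ∈ soloCore b 𝓕', b w = b v → w = v' := by
    intro w hw hbw
    exact (mem_filter.1 hv').2 w (mem_filter.1 hw).1 (hbw.trans h)
  by_cases hW : v' ∈ W
  · simp only [hW, decide_true, Bool.not_true, decide_eq_false_iff_not, not_exists, not_and,
      not_not]
    intro w hw hbw
    rw [huniq w hw hbw]; exact hW
  · simp only [hW, decide_false, Bool.not_false, decide_eq_true_eq]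
    exact ⟨v', hv', h.symm, hW⟩

/-- With no solo core vertex of its label, the target of a vertex is its side. [folklore] -/
private theorem crossTarget_eq_isLeft {W : Finset (Vtx m)} {v : Vtx m}
    (h : ¬ ∃ w ∈ soloCore b 𝓕', b w = b v) : crossTarget b 𝓕' W v = v.isLeft := by
  unfold crossTarget; rw [if_neg h]

/-- The targets depend on `W` only through its trace on any set containing the solo core
vertices. [cite: CavalarEtAl2026, §2, Claim 1, variant] -/
theorem crossTarget_inter {W K : Finset (Vtx m)} (hK : soloCore b 𝓕' ⊆ K) (v : Vtx m) :
    crossTarget b 𝓕' (W ∩ K) v = crossTarget b 𝓕' W v := by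
  unfold crossTarget
  split_ifs with h
  · have hiff : (∃ w ∈ soloCore b 𝓕', b w = b v ∧ w ∉ W ∩ K) ↔
        (∃ w ∈ soloCore b 𝓕', b w = b v ∧ w ∉ W) := by
      refine exists_congr fun w => ?_
      constructor
      · rintro ⟨hw, hb, hn⟩
        exact ⟨hw, hb, fun hW => hn (mem_inter.2 ⟨hW, hK hw⟩)⟩
      · rintro ⟨hw, hb, hn⟩
        exact ⟨hw, hb, fun hW => hn (mem_inter.1 hW).1⟩
    by_cases hq : ∃ w ∈ soloCore b 𝓕', b w = b v ∧ w ∉ W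
    · rw [decide_eq_true hq, decide_eq_true (hiff.2 hq)]
    · rw [decide_eq_false hq, decide_eq_false (fun h' => hq (hiff.1 h'))]
  · rfl

include h𝓕' in
/-- **Biased Claim 1, pointwise**: if every non-core endpoint of some member `M` of a blocky
family hits its target, then every edge of `M` outside the edge core is a cross edge of `W`
(the three cases of CGRSS Claim 1: an edge with both endpoints in the vertex core lies in the
edge core; a core endpoint of an edge outside the edge core is solo and its partner's target is
the opposite side; an edge with no core endpoint has no core vertex of its label, so its left
endpoint targets "in" and its right endpoint "out"). [cite: CavalarEtAl2026, §2, Claim 1, variant] -/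
theorem cross_of_crossTarget {W : Finset (Vtx m)} {M : Finset (Edge m)} (hM : M ∈ 𝓕')
    (hhit : ∀ v ∈ everts M, v ∉ SetFamily.core (𝓕'.image everts) →
      decide (v ∈ W) = crossTarget b 𝓕' W v) :
    M \ core 𝓕' ⊆ crossGraph W := by
  set K := SetFamily.core (𝓕'.image everts) with hK
  intro e he
  rw [mem_crossGraph]
  obtain ⟨heM, heD⟩ := mem_sdiff.1 he
  have hmono : b (Sum.inl e.1) = b (Sum.inr e.2) := (h𝓕' M hM).2.1 e heM
  have huM : (Sum.inl e.1 : Vtx m) ∈ everts M := inl_mem_everts.2 ⟨e, heM, rfl⟩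
  have hvM : (Sum.inr e.2 : Vtx m) ∈ everts M := inr_mem_everts.2 ⟨e, heM, rfl⟩
  -- a core endpoint of `e ∉ D` whose partner is outside the core is solo
  have hsolo : ∀ {w w₂ : Vtx m},
      (w = Sum.inl e.1 ∧ w₂ = Sum.inr e.2) ∨ (w = Sum.inr e.2 ∧ w₂ = Sum.inl e.1) →
      w ∈ K → w₂ ∉ K → w ∈ soloCore b 𝓕' := by
    rintro w w₂ hww hw hw₂
    refine mem_filter.2 ⟨hw, fun w' hw' hbw' => ?_⟩
    have hbw'e : b w' = b (Sum.inl e.1) := by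
      rcases hww with ⟨rfl, rfl⟩ | ⟨rfl, rfl⟩
      · exact hbw'
      · rw [hbw', hmono]
    rcases eq_endpoint_of_label h𝓕' hM heM hw' hbw'e with h | h
    · rcases hww with ⟨rfl, rfl⟩ | ⟨rfl, rfl⟩
      · exact h
      · exact absurd (h ▸ hw') hw₂
    · rcases hww with ⟨rfl, rfl⟩ | ⟨rfl, rfl⟩
      · exact absurd (h ▸ hw') hw₂
      · exact h
  by_cases hu : (Sum.inl e.1 : Vtx m) ∈ K <;> by_cases hv : (Sum.inr e.2 : Vtx m) ∈ K
  · exact absurd (mem_core_of_endpoints h𝓕' hM heM hu hv) heD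
  · -- `u ∈ K` solo, `v ∉ K`: the target of `v` is the side opposite to `u`
    have hus : (Sum.inl e.1 : Vtx m) ∈ soloCore b 𝓕' := hsolo (Or.inl ⟨rfl, rfl⟩) hu hv
    have h1 := hhit _ hvM hv
    rw [crossTarget_eq_not hus hmono.symm] at h1
    revert h1
    by_cases ha : (Sum.inl e.1 : Vtx m) ∈ W <;> by_cases hb : (Sum.inr e.2 : Vtx m) ∈ W <;>
      simp [ha, hb]
  · -- `v ∈ K` solo, `u ∉ K`
    have hvs : (Sum.inr e.2 : Vtx m) ∈ soloCore b 𝓕' := hsolo (Or.inr ⟨rfl, rfl⟩) hv hu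
    have h1 := hhit _ huM hu
    rw [crossTarget_eq_not hvs hmono] at h1
    revert h1
    by_cases ha : (Sum.inl e.1 : Vtx m) ∈ W <;> by_cases hb : (Sum.inr e.2 : Vtx m) ∈ W <;>
      simp [ha, hb]
  · -- both endpoints outside the core: no (solo) core vertex carries the label of `e`
    have hno : ¬ ∃ w ∈ soloCore b 𝓕', b w = b (Sum.inl e.1) := by
      rintro ⟨w, hw, hbw⟩
      rcases eq_endpoint_of_label h𝓕' hM heM (mem_filter.1 hw).1 hbw with h | h
      · exact hu (h ▸ (mem_filter.1 hw).1)
      · exact hv (h ▸ (mem_filter.1 hw).1)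
    have hno' : ¬ ∃ w ∈ soloCore b 𝓕', b w = b (Sum.inr e.2) := by rwa [← hmono]
    have h1 := hhit _ huM hu
    have h2 := hhit _ hvM hv
    rw [crossTarget_eq_isLeft hno] at h1
    rw [crossTarget_eq_isLeft hno'] at h2
    revert h1 h2
    by_cases ha : (Sum.inl e.1 : Vtx m) ∈ W <;> by_cases hb : (Sum.inr e.2 : Vtx m) ∈ W <;>
      simp [ha, hb]

end BiasedClaim

/-! ### Assembly -/

/-- **The Matching Sunflower Lemma for the `p`-biased cross-cut measure** (R7-B of the cell
pnp-ideate, rung F-N1/p3; NOT in print as stated — the `p`-biased cross-cut variant of CGRSS,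
arXiv:2507.16105, Lemma 2; PROVED below, `biasedMatchingSunflower_holds`): there is a universal
`c₀ > 0` such that for `ℓ ≥ 1`, `0 < p ≤ 1/2`, `0 < ε ≤ 1/2`, every family of `ℓ`-matchings of
`K_{m,m}` with at least `(c₀ ℓ log²(ℓ/ε) / p²)^ℓ` members contains an `ε`-matching sunflower for
the `p`-biased cross-cut measure. [cite: CavalarEtAl2026, §2, Claim 1, variant] -/
def BiasedMatchingSunflower : Prop :=
  ∃ c₀ : ℝ, 0 < c₀ ∧ ∀ (m ℓ : ℕ) (p ε : ℝ), 1 ≤ ℓ → 0 < p → p ≤ 1 / 2 → 0 < ε → ε ≤ 1 / 2 →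
    ∀ 𝓕 : Finset (Finset (Edge m)), (∀ M ∈ 𝓕, IsMatching M ∧ #M = ℓ) →
      (c₀ * ℓ * Real.log (ℓ / ε) ^ 2 / p ^ 2) ^ ℓ ≤ (#𝓕 : ℝ) →
        ∃ 𝓕' ⊆ 𝓕, IsCrossMatchingSunflower (m := m) p ε 𝓕'

/-- **R7-B proved**, with `c₀ = 12 · B²`, `B = 2000` the spread-lemma constant. Proof: CGRSS §2
up to Claim 1 verbatim at bias `p` — a labelling `b` consistent with `≥ |𝓕| ℓ!/ℓ^{2ℓ}` members
(`exists_labelling`), the blocky members are determined by their `2ℓ`-sets of endpoints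
(`Consistent.eq_of_everts_eq`), the robust sunflower theorem
(`Literature.Combinatorics.SetFamily.robust_sunflower_spreadConst`) at `(p, ε)` for the vertex
family (threshold `(B log(2ℓ/ε)/p)^{2ℓ} ≤ (12 B² ℓ log²(ℓ/ε)/p²)^ℓ · ℓ!/ℓ^{2ℓ}` by
`log(2ℓ/ε) ≤ 2 log(ℓ/ε)` and `ℓ^ℓ ≤ 3^ℓ ℓ!`); then, instead of the uniform recolouring involution,
the conditional flip coupling `BiasedFlip.sum_biasedWeight_filter_le_symmDiff`
(revealed coordinates = the vertex core `K`, flipped coordinates = the non-core vertices whose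
target is "out of `W`", event = the robustness event `∃ V ∈ 𝒱', V ∖ K ⊆ W`, up-closed) shows that
with `μ_p`-probability `> 1 - ε` some member has all its non-core endpoints on target, and the
pointwise biased Claim 1 (`cross_of_crossTarget`) makes that member a cross member.
[cite: CavalarEtAl2026, Lemma 2 (§1.1; proof §2, Claim 1), variant] [cite: CavalarKumarRossman2022, Thm. 1.3] -/
theorem biasedMatchingSunflower_holds : BiasedMatchingSunflower := by
  refine ⟨12 * SetFamily.spreadConst ^ 2, by have := SetFamily.spreadConst_pos; positivity, ?_⟩
  intro m ℓ p ε hℓ hp0 hp1 hε0 hε1 𝓕 h𝓕 hbig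
  set B : ℝ := SetFamily.spreadConst with hB
  have hBpos : 0 < B := SetFamily.spreadConst_pos
  set L : ℝ := Real.log (ℓ / ε) with hL
  -- positivity of the logarithm
  have hℓr : (1 : ℝ) ≤ ℓ := by exact_mod_cast hℓ
  have hx2 : (2 : ℝ) ≤ ℓ / ε := by rw [le_div_iff₀ hε0]; linarith
  have hL2 : Real.log 2 ≤ L := Real.log_le_log two_pos hx2
  have hLpos : 0 < L := lt_of_lt_of_le (Real.log_pos one_lt_two) hL2
  -- Step 1: a good labelling and the blocky family
  obtain ⟨b, hb⟩ := exists_labelling 𝓕 hℓ h𝓕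
  set 𝓕b := 𝓕.filter fun M => Consistent b M with h𝓕b
  have h𝓕b : ∀ M ∈ 𝓕b, IsMatching M ∧ Consistent b M := fun M hM =>
    ⟨(h𝓕 M (mem_filter.1 hM).1).1, (mem_filter.1 hM).2⟩
  -- Step 2: the vertex family
  set 𝒱 := 𝓕b.image everts with h𝒱
  have hinj : Set.InjOn everts (𝓕b : Set (Finset (Edge m))) := fun M hM M' hM' h =>
    (h𝓕b M hM).2.eq_of_everts_eq (h𝓕b M' hM').2 h
  have h𝒱card : #𝒱 = #𝓕b := card_image_of_injOn hinj
  have h𝒱unif : ∀ V ∈ 𝒱, #V = 2 * ℓ := by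
    intro V hV
    obtain ⟨M, hM, rfl⟩ := mem_image.1 hV
    have hMm : IsMatching M := (h𝓕b M hM).1
    -- a matching with `ℓ` edges covers `2ℓ` vertices
    unfold everts
    rw [card_union_of_disjoint, card_image_of_injOn, card_image_of_injOn,
      (h𝓕 M (mem_filter.1 hM).1).2, two_mul]
    · intro e₁ h₁ e₂ h₂ h
      exact hMm.2 e₁ h₁ e₂ h₂ (Sum.inr_injective h)
    · intro e₁ h₁ e₂ h₂ h
      exact hMm.1 e₁ h₁ e₂ h₂ (Sum.inl_injective h)
    · rw [disjoint_left]
      intro v hv hv'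
      obtain ⟨e, -, rfl⟩ := mem_image.1 hv
      obtain ⟨e', -, h⟩ := mem_image.1 hv'
      exact Sum.inr_ne_inl h
  -- Step 3: the size of `𝒱` beats the robust-sunflower threshold at `(p, ε)`
  have hsize : (B * Real.log (((2 * ℓ : ℕ) : ℝ) / ε) / p) ^ (2 * ℓ) ≤ (#𝒱 : ℝ) := by
    have hlog : Real.log (((2 * ℓ : ℕ) : ℝ) / ε) = Real.log 2 + L := by
      have : ((2 * ℓ : ℕ) : ℝ) / ε = 2 * (ℓ / ε) := by push_cast; ring
      rw [this, Real.log_mul (by norm_num) (by positivity)]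
    have hlogle : Real.log (((2 * ℓ : ℕ) : ℝ) / ε) ≤ 2 * L := by rw [hlog]; linarith
    have hlog0 : 0 ≤ Real.log (((2 * ℓ : ℕ) : ℝ) / ε) := by rw [hlog]; positivity
    -- threshold ≤ (2BL/p)^{2ℓ} = (4 B² L²/p²)^ℓ
    have hT : (B * Real.log (((2 * ℓ : ℕ) : ℝ) / ε) / p) ^ (2 * ℓ) ≤
        (4 * B ^ 2 * L ^ 2 / p ^ 2) ^ ℓ := by
      have h6 : B * Real.log (((2 * ℓ : ℕ) : ℝ) / ε) / p ≤ 2 * B * L / p := by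
        rw [div_le_div_iff_of_pos_right hp0]
        nlinarith
      calc (B * Real.log (((2 * ℓ : ℕ) : ℝ) / ε) / p) ^ (2 * ℓ)
          ≤ (2 * B * L / p) ^ (2 * ℓ) := pow_le_pow_left₀ (by positivity) h6 _
        _ = (4 * B ^ 2 * L ^ 2 / p ^ 2) ^ ℓ := by rw [pow_mul]; congr 1; field_simp; ring
    -- the blocky family is large: #𝓕b ℓ^{2ℓ} ≥ #𝓕 ℓ! ≥ (c₀ ℓ L²/p²)^ℓ ℓ!
    have hbR : (#𝓕 : ℝ) * ℓ.factorial ≤ #𝓕b * (ℓ : ℝ) ^ (2 * ℓ) := by exact_mod_cast hb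
    -- `ℓ^ℓ ≤ 3^ℓ · ℓ!`, from `ℓ^ℓ/ℓ! ≤ e^ℓ ≤ 3^ℓ`
    have hfac : ((ℓ : ℝ)) ^ ℓ ≤ (3 : ℝ) ^ ℓ * ℓ.factorial := by
      have h1 := Real.pow_div_factorial_le_exp (ℓ : ℝ) (show (0 : ℝ) ≤ (ℓ : ℝ) by positivity) ℓ
      have hfp : (0 : ℝ) < ℓ.factorial := by exact_mod_cast Nat.factorial_pos ℓ
      rw [div_le_iff₀ hfp] at h1
      have h2 : Real.exp ℓ ≤ (3 : ℝ) ^ ℓ := by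
        rw [show (ℓ : ℝ) = ℓ * 1 by ring, Real.exp_nat_mul]
        exact pow_le_pow_left₀ (Real.exp_pos 1).le (by have := Real.exp_one_lt_d9; linarith) ℓ
      exact h1.trans (mul_le_mul_of_nonneg_right h2 hfp.le)
    have hℓpow : (0 : ℝ) < (ℓ : ℝ) ^ (2 * ℓ) := by positivity
    have hp2 : (0 : ℝ) < p ^ 2 := by positivity
    rw [h𝒱card]
    refine le_of_mul_le_mul_right ?_ hℓpow
    calc (B * Real.log (((2 * ℓ : ℕ) : ℝ) / ε) / p) ^ (2 * ℓ) * (ℓ : ℝ) ^ (2 * ℓ)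
        ≤ (4 * B ^ 2 * L ^ 2 / p ^ 2) ^ ℓ * (ℓ : ℝ) ^ (2 * ℓ) :=
          mul_le_mul_of_nonneg_right hT hℓpow.le
      _ = (4 * B ^ 2 * L ^ 2 / p ^ 2 * ℓ) ^ ℓ * (ℓ : ℝ) ^ ℓ := by
          rw [pow_mul, ← mul_pow, ← mul_pow]; ring
      _ ≤ (4 * B ^ 2 * L ^ 2 / p ^ 2 * ℓ) ^ ℓ * ((3 : ℝ) ^ ℓ * ℓ.factorial) :=
          mul_le_mul_of_nonneg_left hfac (by positivity)
      _ = (12 * B ^ 2 * ℓ * L ^ 2 / p ^ 2) ^ ℓ * ℓ.factorial := by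
          rw [← mul_assoc, ← mul_pow]; congr 2; field_simp; ring
      _ ≤ #𝓕 * ℓ.factorial := mul_le_mul_of_nonneg_right hbig (by positivity)
      _ ≤ #𝓕b * (ℓ : ℝ) ^ (2 * ℓ) := hbR
  -- Step 4: the vertex sunflower and the corresponding matchings
  obtain ⟨𝒱', h𝒱'sub, h𝒱'two, hrob⟩ := SetFamily.robust_sunflower_spreadConst 𝒱 (2 * ℓ) p ε
    (by omega) hp0 hp1 hε0 hε1 h𝒱unif hsize
  set 𝓕' := 𝓕b.filter fun M => everts M ∈ 𝒱' with h𝓕'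
  have h𝓕'b : ∀ M ∈ 𝓕', IsMatching M ∧ Consistent b M := fun M hM => h𝓕b M (mem_filter.1 hM).1
  have himg : 𝓕'.image everts = 𝒱' := by
    ext V
    constructor
    · intro hV
      obtain ⟨M, hM, rfl⟩ := mem_image.1 hV
      exact (mem_filter.1 hM).2
    · intro hV
      obtain ⟨M, hM, rfl⟩ := mem_image.1 (h𝒱'sub hV)
      exact mem_image.2 ⟨M, mem_filter.2 ⟨hM, hV⟩, rfl⟩
  have h𝓕'card : #𝓕' = #𝒱' := by
    rw [← himg, card_image_of_injOn fun M hM M' hM' h =>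
      hinj (mem_filter.1 hM).1 (mem_filter.1 hM').1 h]
  refine ⟨𝓕', fun M hM => (mem_filter.1 (mem_filter.1 hM).1).1, ?_, ?_⟩
  · rw [h𝓕'card]; exact h𝒱'two
  -- Step 5: the flip coupling and the pointwise Claim 1
  set K := SetFamily.core (𝓕'.image everts) with hK
  have hKV : SetFamily.core 𝒱' = K := by rw [hK, himg]
  set φ : Finset (Vtx m) → Finset (Vtx m) := fun W =>
    (univ \ K).filter fun v => crossTarget b 𝓕' W v = false with hφdef
  have hRN : Disjoint K (univ \ K) := disjoint_sdiff
  have hφN : ∀ W, φ W ⊆ univ \ K := fun W => filter_subset _ _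
  have hsoloK : soloCore b 𝓕' ⊆ K := filter_subset _ _
  have hφR : ∀ W, φ W = φ (W ∩ K) := fun W => by
    simp only [hφdef]
    refine filter_congr fun v _ => ?_
    rw [crossTarget_inter hsoloK]
  have hE : ∀ x ∈ univ \ K, ∀ W : Finset (Vtx m),
      (∃ V ∈ 𝒱', V ⊆ W ∪ SetFamily.core 𝒱') → ∃ V ∈ 𝒱', V ⊆ insert x W ∪ SetFamily.core 𝒱' := by
    rintro x - W ⟨V, hV, hVW⟩
    exact ⟨V, hV, hVW.trans (union_subset_union (subset_insert x W) le_rfl)⟩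
  have hflip := BiasedFlip.sum_biasedWeight_filter_le_symmDiff hp0.le hp1 K (univ \ K) hRN φ hφN hφR
    (fun W => ∃ V ∈ 𝒱', V ⊆ W ∪ SetFamily.core 𝒱') hE
  -- pointwise: after the flip, the robustness event implies the cross-sunflower event
  have hpt : (univ.filter fun W : Finset (Vtx m) =>
      ∃ V ∈ 𝒱', V ⊆ symmDiff W (φ W) ∪ SetFamily.core 𝒱') ⊆
      univ.filter fun W : Finset (Vtx m) => ∃ M ∈ 𝓕', M \ core 𝓕' ⊆ crossGraph W := by
    intro W hW
    obtain ⟨V, hV, hVW⟩ := (mem_filter.1 hW).2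
    rw [← himg] at hV
    obtain ⟨M, hM, rfl⟩ := mem_image.1 hV
    refine mem_filter.2 ⟨mem_univ _, M, hM, cross_of_crossTarget h𝓕'b hM fun v hv hvK => ?_⟩
    have hv' := hVW hv
    rw [mem_union, hKV] at hv'
    rcases hv' with h | h
    · rw [mem_symmDiff] at h
      have hvφ : v ∈ φ W ↔ crossTarget b 𝓕' W v = false := by
        simp only [hφdef, mem_filter, mem_sdiff, mem_univ, true_and]
        exact ⟨fun h => h.2, fun h => ⟨hvK, h⟩⟩
      rcases h with ⟨hvW, hvn⟩ | ⟨hvp, hvW⟩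
      · rw [hvφ] at hvn
        rw [decide_eq_true hvW]
        cases htg : crossTarget b 𝓕' W v
        · exact absurd htg hvn
        · rfl
      · rw [hvφ] at hvp
        rw [decide_eq_false hvW, hvp]
    · exact absurd h hvK
  calc 1 - ε < _ := hrob
    _ ≤ _ := hflip
    _ ≤ _ := sum_le_sum_of_subset_of_nonneg hpt fun W _ _ =>
        SetFamily.biasedWeight_nonneg hp0.le (by linarith) W

end Literature.Computability.Complexity.CGRSS2026.NegLimitedGapPM

end Part4

/-!
## Part 5 — port of `Summits/PneNP/PneNP/Theorems/NegLimitedGapPMMinterms.lean` (13 declarations kept)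

# Route NegLimited — the cross-cut measure, few MATCHING minterms, positive errors 

The perfect-matching instance of the `μ`-closure engine (`NegLimitedMonotoneClosureW.lean`,
`NegLimitedGapPMScheme.lean`), cell record HOME/pnp-ideate-p3/ROUND-7.md §4 (rows C2, C3):

* `crossMeasure p` — the law of the cross-cut graph `crossGraph W`, `W ∼ μ_p` on the `2m` vertices,
  as a weight on the supports `U ⊆ Edge m` (`prW_crossMeasure`: `Pr_μ[E] = Pr_W[E(crossGraph W)]`;
  total mass `1`; edge marginals `≤ 2p`);
* `SunflowerBound c₀` — the biased Matching Sunflower Lemma with an explicit constant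
  (`BiasedMatchingSunflower ↔ ∃ c₀ > 0, SunflowerBound c₀`);
* `card_matching_minimals_lt` — **few MATCHING minterms** (CKR Lemma 2.11 for this measure): a
  `crossMeasure p`-closed up-set has `< (c₀ ℓ log²(ℓ/ε)/p²)^ℓ` minimal members that are
  `ℓ`-matchings, `1 ≤ ℓ ≤ c` (else the sunflower's core enters the family by closedness and kills the
  minimality of two distinct members);
* `sum_perm_lost_le` / `sum_lostSupW_le` / `sum_lostInfW_le` — the POSITIVE per-gate errors for the
  uniform perfect matching `permGraph σ` (only matching minterms are ever charged: a minterm inside a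
  perfect matching is a matching), and `sum_perm_mem_le` — CKR Lemma 2.17 (an approximator `≢ 1`
  accepts few perfect matchings).

(Verbatim declaration-level port — the declarations listed in the Part header count — of the Summits-side module of the PneNP
tree's NegLimited route; route / round / item bookkeeping in the text above is historical.)
-/

section Part5

namespace Literature.Computability.Complexity.CGRSS2026.NegLimitedGapPM

open _root_.Finset Literature.Computability.Complexity Literature.Computability.Complexity.Razborov
  Literature.Computability.Complexity.CKR Literature.Computability.Complexity.PerfectMatching
open Literature.Combinatorics.SetFamily (finsetEquivFun biasedWeight biasedWeight_nonneg sum_biasedWeight sum_biasedWeight_filter_subset)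

variable {m : ℕ}

/-! ### The cross-cut measure on the supports -/

/-- The law of `crossGraph W` for `W ∼ μ_p`, as a weight on edge sets.
[cite: CavalarEtAl2026, Thm. 1 (§1; proof §3–§4) (bookkeeping)] -/
noncomputable def crossMeasure (p : ℝ) (U : Finset (Edge m)) : ℝ :=
  ∑ W ∈ univ.filter (fun W : Finset (Vtx m) => crossGraph W = U), biasedWeight p W

/-- The cross-cut weights are nonnegative for `p ∈ [0,1]`.
[cite: CavalarEtAl2026, Thm. 1 (§1; proof §3–§4) (bookkeeping)] -/
theorem crossMeasure_nonneg {p : ℝ} (hp0 : 0 ≤ p) (hp1 : p ≤ 1) (U : Finset (Edge m)) :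
    0 ≤ crossMeasure p U :=
  sum_nonneg fun W _ => biasedWeight_nonneg hp0 hp1 W

/-- **Push-forward**: `Pr_{crossMeasure p}[E] = Pr_{W ∼ μ_p}[E(crossGraph W)]`.
[cite: CavalarEtAl2026, Thm. 1 (§1; proof §3–§4) (bookkeeping)] -/
theorem prW_crossMeasure (p : ℝ) (E : Finset (Edge m) → Prop) [DecidablePred E] :
    prW (crossMeasure (m := m) p) E =
      ∑ W ∈ univ.filter (fun W : Finset (Vtx m) => E (crossGraph W)), biasedWeight p W := by
  unfold prW crossMeasure
  rw [← sum_fiberwise_of_maps_to (s := univ.filter fun W : Finset (Vtx m) => E (crossGraph W))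
    (t := univ.filter E) (g := fun W => crossGraph W)
    (fun W hW => mem_filter.2 ⟨mem_univ _, (mem_filter.1 hW).2⟩)]
  refine sum_congr rfl fun U hU => sum_congr ?_ fun _ _ => rfl
  ext W
  simp only [mem_filter, mem_univ, true_and]
  constructor
  · intro h; exact ⟨h ▸ (mem_filter.1 hU).2, h⟩
  · exact fun h => h.2

/-- Total mass `1`. [cite: CavalarEtAl2026, Thm. 1 (§1; proof §3–§4) (bookkeeping)] -/
theorem sum_crossMeasure (p : ℝ) : ∑ U, crossMeasure (m := m) p U = 1 := by
  have h := prW_crossMeasure (m := m) p (fun _ => True)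
  unfold prW at h
  rw [filter_true_of_mem (fun _ _ => trivial), filter_true_of_mem (fun _ _ => trivial),
    sum_biasedWeight] at h
  exact h

/-- **Edge marginals**: `Pr[e ∈ crossGraph W] ≤ Pr[u ∈ W] + Pr[v ∈ W] = 2p` (`p ≥ 0`, `p ≤ 1`).
[cite: CavalarEtAl2026, Thm. 1 (§1; proof §3–§4) (bookkeeping)] -/
theorem prW_crossMeasure_mem_le {p : ℝ} (hp0 : 0 ≤ p) (hp1 : p ≤ 1) (e : Edge m) :
    prW (crossMeasure (m := m) p) (fun U : Finset (Edge m) => e ∈ U) ≤ 2 * p := by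
  rw [prW_crossMeasure]
  have hu := sum_biasedWeight_filter_subset (α := Vtx m) p {Sum.inl e.1}
  have hv := sum_biasedWeight_filter_subset (α := Vtx m) p {Sum.inr e.2}
  rw [card_singleton, pow_one] at hu hv
  simp only [singleton_subset_iff] at hu hv
  have hsub : (univ.filter fun W : Finset (Vtx m) => e ∈ crossGraph W) ⊆
      (univ.filter fun W : Finset (Vtx m) => (Sum.inl e.1 : Vtx m) ∈ W) ∪
        univ.filter fun W : Finset (Vtx m) => (Sum.inr e.2 : Vtx m) ∈ W := by
    intro W hW
    have h := (mem_filter.1 hW).2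
    rw [mem_crossGraph] at h
    rw [mem_union, mem_filter, mem_filter]
    by_cases h1 : (Sum.inl e.1 : Vtx m) ∈ W
    · exact Or.inl ⟨mem_univ _, h1⟩
    · right; refine ⟨mem_univ _, ?_⟩
      by_contra h2
      exact h (iff_of_false h1 h2)
  calc ∑ W ∈ univ.filter (fun W : Finset (Vtx m) => e ∈ crossGraph W), biasedWeight p W
      ≤ ∑ W ∈ (univ.filter fun W : Finset (Vtx m) => (Sum.inl e.1 : Vtx m) ∈ W) ∪
          univ.filter (fun W : Finset (Vtx m) => (Sum.inr e.2 : Vtx m) ∈ W), biasedWeight p W :=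
        sum_le_sum_of_subset_of_nonneg hsub fun W _ _ => biasedWeight_nonneg hp0 hp1 W
    _ ≤ ∑ W ∈ univ.filter (fun W : Finset (Vtx m) => (Sum.inl e.1 : Vtx m) ∈ W), biasedWeight p W +
          ∑ W ∈ univ.filter (fun W : Finset (Vtx m) => (Sum.inr e.2 : Vtx m) ∈ W),
            biasedWeight p W :=
        ApproxScheme.sum_union_le_of_nonneg (fun W => biasedWeight_nonneg hp0 hp1 W) _ _
    _ = 2 * p := by rw [hu, hv]; ring

/-! ### Few matching minterms of a closed family -/

/-- The biased Matching Sunflower Lemma with an explicit constant `c₀`.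
[cite: CavalarEtAl2026, Thm. 1 (§1; proof §3–§4) (bookkeeping)] -/
def SunflowerBound (c₀ : ℝ) : Prop :=
  ∀ (m ℓ : ℕ) (p ε : ℝ), 1 ≤ ℓ → 0 < p → p ≤ 1 / 2 → 0 < ε → ε ≤ 1 / 2 →
    ∀ 𝓕 : Finset (Finset (Edge m)), (∀ M ∈ 𝓕, IsMatching M ∧ #M = ℓ) →
      (c₀ * ℓ * Real.log (ℓ / ε) ^ 2 / p ^ 2) ^ ℓ ≤ (#𝓕 : ℝ) →
        ∃ 𝓕' ⊆ 𝓕, IsCrossMatchingSunflower (m := m) p ε 𝓕'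

/-- `BiasedMatchingSunflower` provides a constant for `SunflowerBound`.
[cite: CavalarEtAl2026, Thm. 1 (§1; proof §3–§4) (bookkeeping)] -/
theorem exists_sunflowerBound (h : BiasedMatchingSunflower) : ∃ c₀ : ℝ, 0 < c₀ ∧ SunflowerBound c₀ :=
  h

/-- The sunflower threshold `(c₀ ℓ log²(ℓ/ε) / p²)^ℓ`.
[cite: CavalarEtAl2026, Thm. 1 (§1; proof §3–§4) (bookkeeping)] -/
noncomputable def thr (c₀ p ε : ℝ) (ℓ : ℕ) : ℝ := (c₀ * ℓ * Real.log (ℓ / ε) ^ 2 / p ^ 2) ^ ℓ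

/-- **Few MATCHING minterms** (CKR Lemma 2.11 for the cross-cut measure, via the biased Matching
Sunflower Lemma): a `crossMeasure p`-closed up-set `𝒯` (parameters `c`, `ε`) has fewer than
`(c₀ ℓ log²(ℓ/ε)/p²)^ℓ` minimal members that are `ℓ`-matchings, for `1 ≤ ℓ ≤ c` — otherwise these
minterms contain an `ε`-matching sunflower `𝓕'` for the measure, whose core `D` (`|D| < ℓ ≤ c`)
satisfies `Pr_W[D ∪ crossGraph W ∈ 𝒯] > 1 - ε`, hence `D ∈ 𝒯` by closedness, contradicting the
minimality of the (at least two, distinct) members of `𝓕'`.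
[cite: CavalarEtAl2026, Thm. 1 (§1; proof §3–§4) (bookkeeping)] -/
theorem card_matching_minimals_lt {c₀ p ε : ℝ} (hSF : SunflowerBound c₀) (hp0 : 0 < p)
    (hp1 : p ≤ 1 / 2) (hε0 : 0 < ε) (hε1 : ε ≤ 1 / 2) {c : ℕ} {𝒯 : Finset (Finset (Edge m))}
    (hup : IsUpperSet (𝒯 : Set (Finset (Edge m)))) (hcl : IsClosedFamW (crossMeasure p) c ε 𝒯)
    {ℓ : ℕ} (hℓ1 : 1 ≤ ℓ) (hℓc : ℓ ≤ c) :
    (#((minimals 𝒯).filter fun A => IsMatching A ∧ #A = ℓ) : ℝ) < thr c₀ p ε ℓ := by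
  by_contra hge
  rw [not_lt] at hge
  set F := (minimals 𝒯).filter fun A => IsMatching A ∧ #A = ℓ with hF
  have hFdef : ∀ M ∈ F, IsMatching M ∧ #M = ℓ := fun M hM => (mem_filter.1 hM).2
  obtain ⟨𝓕', h𝓕'F, h2, hrob⟩ := hSF m ℓ p ε hℓ1 hp0 hp1 hε0 hε1 F hFdef hge
  set D := PerfectMatching.core 𝓕' with hD
  -- two distinct members
  obtain ⟨M₁, hM₁, M₂, hM₂, hne⟩ := one_lt_card.1 (by omega : 1 < #𝓕')
  have hM₁F := h𝓕'F hM₁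
  have hM₂F := h𝓕'F hM₂
  have hDc : #D ≤ c :=
    ((card_le_card (core_subset hM₁)).trans (hFdef M₁ hM₁F).2.le).trans hℓc
  -- the core is forced into `𝒯` by closedness
  have hDT : D ∈ 𝒯 := by
    refine hcl D hDc (hrob.trans_le ?_)
    rw [prW_crossMeasure]
    refine sum_le_sum_of_subset_of_nonneg (fun W hW => ?_)
      fun W _ _ => biasedWeight_nonneg hp0.le (by linarith) W
    obtain ⟨M, hM, hMW⟩ := (mem_filter.1 hW).2
    refine mem_filter.2 ⟨mem_univ _, ?_⟩
    have hMT : M ∈ 𝒯 := minimals_subset _ (mem_filter.1 (h𝓕'F hM)).1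
    refine hup (show M ⊆ D ∪ crossGraph W from fun e he => ?_) hMT
    by_cases heD : e ∈ D
    · exact mem_union_left _ heD
    · exact mem_union_right _ (hMW (mem_sdiff.2 ⟨he, heD⟩))
  -- contradiction with minimality
  have h1 : D = M₁ := (mem_minimals.1 (mem_filter.1 hM₁F).1).2 D hDT (core_subset hM₁)
  have h2' : D = M₂ := (mem_minimals.1 (mem_filter.1 hM₂F).1).2 D hDT (core_subset hM₂)
  exact hne (h1.symm.trans h2')

/-! ### Errors on the positive test inputs: uniform perfect matchings -/

/-- The input of a perfect matching, by support. [cite: CavalarEtAl2026, Thm. 1 (§1; proof §3–§4) (bookkeeping)] -/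
theorem finsetEquivFun_permGraph (σ : Equiv.Perm (Fin m)) :
    finsetEquivFun (permGraph σ) = permInput σ := by
  funext e
  simp [permInput, Literature.Combinatorics.SetFamily.finsetEquivFun]

/-- **Probability that the random perfect matching passes through the matching minterms of sizes in
`L ⊆ [1, c]`**: `∑_{A matching minterm, |A| ∈ L} Pr_σ[A ⊆ permGraph σ] ≤ ∑_{ℓ ∈ L} thr(ℓ) (m-ℓ)!/m!`.
[cite: CavalarEtAl2026, Thm. 1 (§1; proof §3–§4) (bookkeeping)] -/
theorem sum_card_filter_supset_permGraph_le {c₀ p ε : ℝ} (hSF : SunflowerBound c₀) (hc0 : 0 ≤ c₀)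
    (hp0 : 0 < p) (hp1 : p ≤ 1 / 2) (hε0 : 0 < ε) (hε1 : ε ≤ 1 / 2) {c : ℕ}
    {𝒯 : Finset (Finset (Edge m))} (hup : IsUpperSet (𝒯 : Set (Finset (Edge m))))
    (hcl : IsClosedFamW (crossMeasure p) c ε 𝒯) (L : Finset ℕ) (hL : ∀ ℓ ∈ L, 1 ≤ ℓ ∧ ℓ ≤ c) :
    ∑ A ∈ (minimals 𝒯).filter (fun A => IsMatching A ∧ #A ∈ L),
        (#(univ.filter fun σ : Equiv.Perm (Fin m) => A ⊆ permGraph σ) : ℝ) / m.factorial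
      ≤ ∑ ℓ ∈ L, thr c₀ p ε ℓ * ((m - ℓ).factorial / m.factorial) := by
  have hmf : (0 : ℝ) < m.factorial := by exact_mod_cast Nat.factorial_pos m
  rw [← sum_fiberwise_of_maps_to (s := (minimals 𝒯).filter fun A => IsMatching A ∧ #A ∈ L) (t := L)
    (g := card) fun A hA => (mem_filter.1 hA).2.2]
  refine sum_le_sum fun ℓ hℓ => ?_
  obtain ⟨hℓ1, hℓc⟩ := hL ℓ hℓ
  have hset : ((minimals 𝒯).filter fun A => IsMatching A ∧ #A ∈ L).filter (fun A => #A = ℓ)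
      = (minimals 𝒯).filter fun A => IsMatching A ∧ #A = ℓ := by
    ext A
    simp only [mem_filter]
    constructor
    · rintro ⟨⟨h1, h2, -⟩, h3⟩; exact ⟨h1, h2, h3⟩
    · rintro ⟨h1, h2, h3⟩; exact ⟨⟨h1, h2, h3 ▸ hℓ⟩, h3⟩
  have hterm : ∀ A ∈ ((minimals 𝒯).filter fun A => IsMatching A ∧ #A ∈ L).filter (fun A => #A = ℓ),
      (#(univ.filter fun σ : Equiv.Perm (Fin m) => A ⊆ permGraph σ) : ℝ) / m.factorial
        ≤ (m - ℓ).factorial / m.factorial := by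
    intro A hA
    rw [hset] at hA
    obtain ⟨-, hAm, hAℓ⟩ := mem_filter.1 hA
    refine div_le_div_of_nonneg_right ?_ hmf.le
    rw [← hAℓ]
    exact_mod_cast card_filter_supset_permGraph_le hAm
  have hcount := card_matching_minimals_lt (m := m) hSF hp0 hp1 hε0 hε1 hup hcl hℓ1 hℓc
  have hthr0 : 0 ≤ thr c₀ p ε ℓ := by
    unfold thr
    have : 0 ≤ Real.log (ℓ / ε) ^ 2 := sq_nonneg _
    positivity
  calc ∑ A ∈ ((minimals 𝒯).filter fun A => IsMatching A ∧ #A ∈ L).filter (fun A => #A = ℓ),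
        (#(univ.filter fun σ : Equiv.Perm (Fin m) => A ⊆ permGraph σ) : ℝ) / m.factorial
      ≤ ∑ A ∈ ((minimals 𝒯).filter fun A => IsMatching A ∧ #A ∈ L).filter (fun A => #A = ℓ),
          ((m - ℓ).factorial / m.factorial : ℝ) := sum_le_sum hterm
    _ = #((minimals 𝒯).filter fun A => IsMatching A ∧ #A = ℓ) * ((m - ℓ).factorial / m.factorial : ℝ) := by
        rw [sum_const, nsmul_eq_mul, hset]
    _ ≤ thr c₀ p ε ℓ * ((m - ℓ).factorial / m.factorial) :=
        mul_le_mul_of_nonneg_right hcount.le (by positivity)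

/-- **Approximation loses little positive weight** (CKR Lemma 2.16 + few matching minterms): if the
up-set `ℋ` has all minterms of size `≤ c`, the perfect matchings `σ` with `permGraph σ ∈ ℋ` but
`permGraph σ ∉ trim(cl_μ(ℋ))` have probability `≤ ∑_{c/2 < ℓ ≤ c} thr(ℓ) (m-ℓ)!/m!` (a minterm of
the closure inside `permGraph σ` is a MATCHING of size in `(c/2, c]`).
[cite: CavalarEtAl2026, Thm. 1 (§1; proof §3–§4) (bookkeeping)] -/
theorem sum_perm_lost_le {c₀ p ε : ℝ} (hSF : SunflowerBound c₀) (hc0 : 0 ≤ c₀) (hp0 : 0 < p)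
    (hp1 : p ≤ 1 / 2) (hε0 : 0 < ε) (hε1 : ε ≤ 1 / 2) {c : ℕ} {ℋ : Finset (Finset (Edge m))}
    (hℋ : ∀ A ∈ minimals ℋ, #A ≤ c) :
    ∑ _σ ∈ univ.filter (fun σ : Equiv.Perm (Fin m) =>
        permGraph σ ∈ ℋ ∧ permGraph σ ∉ trim c (closureW (crossMeasure p) c ε ℋ)),
        (1 / m.factorial : ℝ)
      ≤ ∑ ℓ ∈ Ioc (c / 2) c, thr c₀ p ε ℓ * ((m - ℓ).factorial / m.factorial) := by
  have hmf : (0 : ℝ) < m.factorial := by exact_mod_cast Nat.factorial_pos m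
  have hμ0 : ∀ U : Finset (Edge m), 0 ≤ crossMeasure p U :=
    fun U => crossMeasure_nonneg hp0.le (by linarith) U
  set 𝒯 := closureW (crossMeasure (m := m) p) c ε ℋ with h𝒯
  set 𝓜 := (minimals 𝒯).filter fun A => IsMatching A ∧ #A ∈ Ioc (c / 2) c with h𝓜
  have hcover : (univ.filter fun σ : Equiv.Perm (Fin m) => permGraph σ ∈ ℋ ∧ permGraph σ ∉ trim c 𝒯)
      ⊆ 𝓜.biUnion fun A => univ.filter fun σ : Equiv.Perm (Fin m) => A ⊆ permGraph σ := by
    intro σ hσ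
    obtain ⟨h1, h2⟩ := (mem_filter.1 hσ).2
    obtain ⟨A, hA, hgt, hle, hAσ⟩ := exists_minimal_of_mem_of_not_mem_trim_closureW hℋ h1 h2
    exact mem_biUnion.2 ⟨A, mem_filter.2 ⟨hA, (isMatching_permGraph σ).subset hAσ,
      mem_Ioc.2 ⟨hgt, hle⟩⟩, mem_filter.2 ⟨mem_univ _, hAσ⟩⟩
  have hsizes : ∀ ℓ ∈ Ioc (c / 2) c, 1 ≤ ℓ ∧ ℓ ≤ c := fun ℓ hℓ => by
    rw [mem_Ioc] at hℓ; omega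
  have hmain := sum_card_filter_supset_permGraph_le (m := m) hSF hc0 hp0 hp1 hε0 hε1
    (isUpperSet_closureW ℋ) (isClosedFamW_closureW hμ0 ℋ) (Ioc (c / 2) c) hsizes
  calc ∑ _σ ∈ univ.filter (fun σ : Equiv.Perm (Fin m) => permGraph σ ∈ ℋ ∧ permGraph σ ∉ trim c 𝒯),
        (1 / m.factorial : ℝ)
      = #(univ.filter fun σ : Equiv.Perm (Fin m) => permGraph σ ∈ ℋ ∧ permGraph σ ∉ trim c 𝒯)
          * (1 / m.factorial : ℝ) := by rw [sum_const, nsmul_eq_mul]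
    _ ≤ (∑ A ∈ 𝓜, (#(univ.filter fun σ : Equiv.Perm (Fin m) => A ⊆ permGraph σ) : ℝ))
          * (1 / m.factorial) := by
        refine mul_le_mul_of_nonneg_right ?_ (by positivity)
        exact_mod_cast (card_le_card hcover).trans card_biUnion_le
    _ = ∑ A ∈ 𝓜, (#(univ.filter fun σ : Equiv.Perm (Fin m) => A ⊆ permGraph σ) : ℝ) / m.factorial := by
        rw [sum_mul]; exact sum_congr rfl fun A _ => by ring
    _ ≤ _ := hmain

/-- **CKR Lemma 2.17 for perfect matchings**: an approximator `𝒜` not containing `∅` (i.e. `≢ 1`)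
accepts the uniform perfect matching with probability `≤ ∑_{1 ≤ ℓ ≤ c/2} thr(ℓ) (m-ℓ)!/m!`.
[cite: CavalarEtAl2026, Thm. 1 (§1; proof §3–§4) (bookkeeping)] -/
theorem sum_perm_mem_le {c₀ p ε : ℝ} (hSF : SunflowerBound c₀) (hc0 : 0 ≤ c₀) (hp0 : 0 < p)
    (hp1 : p ≤ 1 / 2) (hε0 : 0 < ε) (hε1 : ε ≤ 1 / 2) {c : ℕ} {𝒜 : Finset (Finset (Edge m))}
    (h𝒜 : IsApproxW (crossMeasure p) c ε 𝒜) (h0 : ∅ ∉ 𝒜) :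
    ∑ _σ ∈ univ.filter (fun σ : Equiv.Perm (Fin m) => permGraph σ ∈ 𝒜), (1 / m.factorial : ℝ)
      ≤ ∑ ℓ ∈ Icc 1 (c / 2), thr c₀ p ε ℓ * ((m - ℓ).factorial / m.factorial) := by
  have hmf : (0 : ℝ) < m.factorial := by exact_mod_cast Nat.factorial_pos m
  obtain ⟨𝒯, hup, hcl, rfl⟩ := h𝒜
  set 𝓜 := (minimals 𝒯).filter fun A => IsMatching A ∧ #A ∈ Icc 1 (c / 2) with h𝓜
  have hcover : (univ.filter fun σ : Equiv.Perm (Fin m) => permGraph σ ∈ trim c 𝒯)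
      ⊆ 𝓜.biUnion fun A => univ.filter fun σ : Equiv.Perm (Fin m) => A ⊆ permGraph σ := by
    intro σ hσ
    obtain ⟨A, hA, h1, h2, hAσ⟩ := exists_minimal_of_mem_trim h0 (mem_filter.1 hσ).2
    exact mem_biUnion.2 ⟨A, mem_filter.2 ⟨hA, (isMatching_permGraph σ).subset hAσ,
      mem_Icc.2 ⟨h1, h2⟩⟩, mem_filter.2 ⟨mem_univ _, hAσ⟩⟩
  have hsizes : ∀ ℓ ∈ Icc 1 (c / 2), 1 ≤ ℓ ∧ ℓ ≤ c := fun ℓ hℓ => by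
    rw [mem_Icc] at hℓ; omega
  have hmain := sum_card_filter_supset_permGraph_le (m := m) hSF hc0 hp0 hp1 hε0 hε1 hup hcl
    (Icc 1 (c / 2)) hsizes
  calc ∑ _σ ∈ univ.filter (fun σ : Equiv.Perm (Fin m) => permGraph σ ∈ trim c 𝒯), (1 / m.factorial : ℝ)
      = #(univ.filter fun σ : Equiv.Perm (Fin m) => permGraph σ ∈ trim c 𝒯) * (1 / m.factorial : ℝ) := by
        rw [sum_const, nsmul_eq_mul]
    _ ≤ (∑ A ∈ 𝓜, (#(univ.filter fun σ : Equiv.Perm (Fin m) => A ⊆ permGraph σ) : ℝ))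
          * (1 / m.factorial) := by
        refine mul_le_mul_of_nonneg_right ?_ (by positivity)
        exact_mod_cast (card_le_card hcover).trans card_biUnion_le
    _ = ∑ A ∈ 𝓜, (#(univ.filter fun σ : Equiv.Perm (Fin m) => A ⊆ permGraph σ) : ℝ) / m.factorial := by
        rw [sum_mul]; exact sum_congr rfl fun A _ => by ring
    _ ≤ _ := hmain

end Literature.Computability.Complexity.CGRSS2026.NegLimitedGapPM

end Part5

/-!
## Part 6 — port of `Summits/PneNP/PneNP/Theorems/KarlinRubinMonotoneBlindCoverUpset.lean` (1 declarations kept)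

# Crux `MonotoneBlind` , line `Sketch`: up-sets, biased measures and cheap covers

Vertex-lattice bookkeeping for the completeness of the dual cover certificate of line `Sketch`
(`Cruxes/MonotoneBlind/Lines/Sketch.lean`; the assembly is in
`KarlinRubinMonotoneBlindCoverCompleteness.lean`). For an UP-SET `U` of vertex subsets of `Kₙ`:

* `density_powersetCard_mono_of_upset` — the uniform `j`-set density of `U` increases with `j`
  (double counting `card_filter_powersetCard_mul_choose_le_of_upset`);
* `sum_biasedWeight_upset_le` — `μ_p(U) ≤ (k-set density of U) + Pr_p[|W| > k]`, with the mean
  size `sum_biasedWeight_mul_card` (`E_p|W| = p|X|`) and the Markov tail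
  `mul_sum_biasedWeight_card_gt_le`;
* `exists_cover_cost_lt_one_of_biased_le_half` — contrapositive of the **Park–Pham theorem**
  (`Literature.Combinatorics.SetFamily.parkPham_spreadConst`, Kahn–Kalai conjecture, `p`-biased
  form): `μ_p(U) ≤ 1/2` forces a cover of `U` of `q`-cost `< 1`, `q = p/(B log 2n)`;
* `sum_pow_card_le_of_scale`, `coverCost_ennreal_eq_ofReal`, `natCast_div_le_quarter` — rescaling
  and `ℝ≥0∞` bookkeeping;
* `exists_cheap_cover_of_kSet_le` — **the deterministic core at one `n`**: if the uniform-`k'`-set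
  measure of `U` is `≤ 1/4` and `5 B log(2n) · D ≤ η k'`, then `U` has a cover of `(D/n)`-cost
  `≤ η`.

All `--supports stmt-PneNP-18027`; no definitions.

References: J. Park, H. T. Pham, J. Amer. Math. Soc. 37 (2024), Thm. 1.1 [ParkPham2024];
T. Bell, Electron. J. Combin. 30(2) (2023), Thm. 3 [Bell2023]; M. Talagrand, STOC 2010 [Talagrand2010].

(Verbatim declaration-level port — the declarations listed in the Part header count — of the Summits-side module of the PneNP
tree's NegLimited route; route / round / item bookkeeping in the text above is historical.)
-/

section Part6

namespace Literature.Computability.Complexity.CGRSS2026.MonotoneBlind.VertexCover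

open Literature.Computability.Complexity Literature.Probability.RandomGraphs.PlantedClique _root_.Filter _root_.Finset
open Literature.Combinatorics.SetFamily
open scoped _root_.ENNReal _root_.Topology _root_.Classical

/-! ### Uniform `j`-set densities of an up-set are monotone in `j` -/

/-- **Mean size under the biased measure**: `E_p |W| = p · |X|`. [cite: CavalarEtAl2026, Thm. 1 (§1; proof §3–§4) (bookkeeping)] -/
theorem sum_biasedWeight_mul_card {α : Type*} [Fintype α] [DecidableEq α] (p : ℝ) :
    ∑ W : Finset α, biasedWeight p W * (#W : ℝ) = p * Fintype.card α := by
  have hcard : ∀ W : Finset α, (#W : ℝ) = ∑ v : α, if v ∈ W then (1 : ℝ) else 0 := by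
    intro W
    rw [Finset.sum_boole, Finset.filter_mem_eq_inter, Finset.univ_inter]
  simp_rw [hcard, mul_sum]
  rw [sum_comm]
  have hv : ∀ v : α, ∑ W : Finset α, biasedWeight p W * (if v ∈ W then (1 : ℝ) else 0) = p := by
    intro v
    have h := sum_biasedWeight_filter_subset (α := α) p {v}
    rw [card_singleton, pow_one, sum_filter] at h
    refine Eq.trans (sum_congr rfl fun W _ => ?_) h
    by_cases hvW : v ∈ W
    · simp [hvW]
    · simp [hvW]
  simp_rw [hv]
  rw [sum_const, card_univ, nsmul_eq_mul, mul_comm]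

end Literature.Computability.Complexity.CGRSS2026.MonotoneBlind.VertexCover

end Part6

/-!
## Part 7 — port of `Summits/PneNP/PneNP/Theorems/NegLimitedDeficientMass.lean` (2 declarations kept)

# Route NegLimited — R7-C2 `DeficientMass`: at bias `1/8` half of the mass sits on `|W| ≤ m/2` 

Registered stub `stub_deficientMass` of the skeleton line `r7-crosscut` for item T5 =
`NegLimited.GapPerfectMatchingQuasipoly` . The statement `DeficientMass` is copied verbatim from the cell's shared
definitions file (HOME/pnp-ideate-p3/turnkey-R8/NegLimitedGapPMDefs.lean) into the shared namespace
`Summit.PneNP.PneNP.Theorems.NegLimitedGapPM`: for the `1/8`-biased random vertex set `W` of the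
`2m` vertices of `K_{m,m}`, `Pr[2|W| ≤ m] ≥ 1/2` (`m ≥ 1`). Proof: Markov's inequality
(`Literature.Combinatorics.SetFamily.mul_sum_biasedWeight_filter_lt_le` at threshold `m/2`) with the
mean size `E_{1/8}|W| = 2m/8 = m/4` (`MonotoneBlind.VertexCover.sum_biasedWeight_mul_card`), so
`Pr[|W| > m/2] ≤ 1/2`, and the complement via `sum_biasedWeight`. Role on the line: the cross-cut
graph `crossGraph W` has matching number `≤ |W|`, hence is `K`-deficient for every `K ≥ 2` on this
event (`crossDeficient_holds` of the skeleton) — the negative test distribution of T5⁺ has mass `≥ 1/2`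
on deficient graphs.

(Verbatim declaration-level port — the declarations listed in the Part header count — of the Summits-side module of the PneNP
tree's NegLimited route; route / round / item bookkeeping in the text above is historical.)
-/

section Part7

namespace Literature.Computability.Complexity.CGRSS2026.NegLimitedGapPM

open _root_.Finset
open Literature.Computability.Complexity.PerfectMatching (Vtx)
open Literature.Combinatorics.SetFamily

/-- R7-C2: at bias `1/8`, at least half of the mass has `#W ≤ m/2` (statement verbatim from the
skeleton line `r7-crosscut`; proved below). [cite: CavalarEtAl2026, Thm. 1 (§1; proof §3–§4) (bookkeeping)] -/
def DeficientMass : Prop :=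
  ∀ m : ℕ, 1 ≤ m →
    (1 / 2 : ℝ) ≤ ∑ W ∈ univ.filter (fun W : Finset (Vtx m) => 2 * #W ≤ m), biasedWeight (1 / 8) W

/-- **R7-C2 proved**: Markov at threshold `m/2` with `E_{1/8}|W| = m/4`.
[cite: CavalarEtAl2026, Thm. 1 (§1; proof §3–§4) (bookkeeping)] -/
theorem deficientMass_holds : DeficientMass := by
  intro m hm
  have hmr : (0 : ℝ) < m := by exact_mod_cast hm
  -- the complementary event, in the real form used by Markov's inequality
  have hcompl : (univ.filter fun W : Finset (Vtx m) => ¬ 2 * #W ≤ m) =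
      univ.filter fun W : Finset (Vtx m) => (m : ℝ) / 2 < (#W : ℝ) := by
    refine filter_congr fun W _ => ?_
    rw [not_le, div_lt_iff₀ (two_pos : (0 : ℝ) < 2), mul_comm]
    exact_mod_cast Iff.rfl
  -- total mass splits over the event and its complement
  have htot : ∑ W ∈ univ.filter (fun W : Finset (Vtx m) => 2 * #W ≤ m), biasedWeight (1 / 8) W +
      ∑ W ∈ univ.filter (fun W : Finset (Vtx m) => (m : ℝ) / 2 < (#W : ℝ)), biasedWeight (1 / 8) W
        = 1 := by
    rw [← hcompl, sum_filter_add_sum_filter_not, sum_biasedWeight]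
  -- Markov: (m/2) · Pr[|W| > m/2] ≤ E|W| = (1/8) · 2m
  have hmarkov := mul_sum_biasedWeight_filter_lt_le (α := Vtx m) (p := 1 / 8) (by norm_num)
    (by norm_num) ((m : ℝ) / 2) (fun W => (#W : ℝ)) fun W => Nat.cast_nonneg _
  rw [MonotoneBlind.VertexCover.sum_biasedWeight_mul_card] at hmarkov
  have hcard : (Fintype.card (Vtx m) : ℝ) = 2 * m := by
    rw [Fintype.card_sum, Fintype.card_fin]; push_cast; ring
  rw [hcard] at hmarkov
  -- hence Pr[|W| > m/2] ≤ 1/2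
  have htail : ∑ W ∈ univ.filter (fun W : Finset (Vtx m) => (m : ℝ) / 2 < (#W : ℝ)),
      biasedWeight (1 / 8) W ≤ 1 / 2 := by
    by_contra h
    rw [not_le] at h
    have : (m : ℝ) / 2 * (1 / 2) < (m : ℝ) / 2 *
        ∑ W ∈ univ.filter (fun W : Finset (Vtx m) => (m : ℝ) / 2 < (#W : ℝ)),
          biasedWeight (1 / 8) W := mul_lt_mul_of_pos_left h (by positivity)
    linarith
  linarith

end Literature.Computability.Complexity.CGRSS2026.NegLimitedGapPM

end Part7

/-!
## Part 8 — port of `Summits/PneNP/PneNP/Theorems/NegLimitedGapPMParametric.lean` (8 declarations kept)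

# Route NegLimited — the gap perfect-matching lower bound, parametric form 

The analogue of CKR Thm. 2.19 (tree: `CKR.harnikRaz_size_mul_ge`, `HarnikRazLowerBound.lean`) for the
PROMISE problem `GapPM_K` (accept every graph with a perfect matching, reject every `K`-deficient
graph), cell record HOME/pnp-ideate-p3/ROUND-7.md §4 ("FINAL INEQUALITY"): run the approximation
method (`exists_approxW`) with the `μ`-closure scheme for `μ = crossMeasure (1/8)` (law of the
`1/8`-biased cross-cut graph), positive test inputs the uniform perfect matchings. Since every perfect
matching is accepted, and the cross-cut graphs with `2|W| ≤ m` (mass `≥ 1/2`, `DeficientMass`) are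
`K`-deficient (`CrossDeficient`) hence rejected, one gets (`gapPM_dichotomy`): EITHER the output
approximator is `≡ 1` and `1/2 ≤ size · ε · #{A : |A| ≤ c}`, OR it is not and
`1 - S ≤ size · δP` with `S = ∑_{1 ≤ ℓ ≤ c/2} thr(ℓ)(m-ℓ)!/m!`, `δP = ∑_{c/2 < ℓ ≤ c} thr(ℓ)(m-ℓ)!/m!`,
`thr(ℓ) = (64 c₀ ℓ log²(ℓ/ε))^ℓ` the biased-sunflower threshold at `p = 1/8`. This file also
DECLARES `Deficient`, `CrossDeficient` (verbatim from HOME/pnp-ideate-p3/turnkey-R8/NegLimitedGapPMDefs.lean,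
shared namespace) with p3's proof `crossDeficient_holds`. The parameter discharge (`w = ⌊m^{1/3-δ/2}⌋`, `c = 2w`, `ε = m^{-5w}`) is in `NegLimitedGapPMExp.lean`.

(Verbatim declaration-level port — the declarations listed in the Part header count — of the Summits-side module of the PneNP
tree's NegLimited route; route / round / item bookkeeping in the text above is historical.)
-/

section Part8

namespace Literature.Computability.Complexity.CGRSS2026.NegLimitedGapPM

open _root_.Finset Literature.Computability.Complexity Literature.Computability.Complexity.Razborov
  Literature.Computability.Complexity.CKR Literature.Computability.Complexity.PerfectMatching
open Literature.Combinatorics.SetFamily (finsetEquivFun biasedWeight biasedWeight_nonneg sum_biasedWeight)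
open Literature.Barriers.PneNP (perfectMatchingFn perfectMatchingFn_permInput)

variable {m : ℕ}

/-! ### Deficiency (statements verbatim from the skeleton line `r7-crosscut`; R7-C1 proved by p3) -/

/-- `K`-deficiency, spelled exactly as in the route item.
[cite: CavalarEtAl2026, Thm. 1 (§1; proof §3–§4) (bookkeeping)] -/
def Deficient (m K : ℕ) (b : Edge m → Bool) : Prop :=
  ∀ D : Finset (Edge m), IsMatching D → (∀ e ∈ D, b e = true) → D.card + m / K ≤ m

/-- R7-C1: small cross-cut graphs are deficient. [cite: CavalarEtAl2026, Thm. 1 (§1; proof §3–§4) (bookkeeping)] -/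
def CrossDeficient : Prop :=
  ∀ (m K : ℕ) (W : Finset (Vtx m)), 2 ≤ K → 2 * #W ≤ m → Deficient m K (crossInput W)

/-- R7-C1 PROVED: a matching inside `crossGraph W` injects into `W` via its `W`-endpoint.
[cite: CavalarEtAl2026, Thm. 1 (§1; proof §3–§4) (bookkeeping)] -/
theorem crossDeficient_holds : CrossDeficient := by
  classical
  intro m K W hK hW D hD hDW
  have hcard : D.card ≤ #W := by
    refine Finset.card_le_card_of_injOn
      (fun e : Edge m => if Sum.inl e.1 ∈ W then (Sum.inl e.1 : Vtx m) else Sum.inr e.2) ?_ ?_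
    · intro e he
      have h := hDW e he
      simp only [crossInput, crossGraph, decide_eq_true_eq, Finset.mem_filter, Finset.mem_univ,
        true_and] at h
      show (if Sum.inl e.1 ∈ W then (Sum.inl e.1 : Vtx m) else Sum.inr e.2) ∈ (W : Set (Vtx m))
      rw [Finset.mem_coe]
      split_ifs with h1
      · exact h1
      · by_contra h2
        exact h (iff_of_false h1 h2)
    · intro e₁ he₁ e₂ he₂ hfe
      have hfe' : (if Sum.inl e₁.1 ∈ W then (Sum.inl e₁.1 : Vtx m) else Sum.inr e₁.2)
          = (if Sum.inl e₂.1 ∈ W then (Sum.inl e₂.1 : Vtx m) else Sum.inr e₂.2) := hfe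
      by_cases h1 : Sum.inl e₁.1 ∈ W
      · by_cases h2 : Sum.inl e₂.1 ∈ W
        · rw [if_pos h1, if_pos h2] at hfe'
          exact hD.1 e₁ he₁ e₂ he₂ (Sum.inl.inj hfe')
        · rw [if_pos h1, if_neg h2] at hfe'
          exact absurd hfe' Sum.inl_ne_inr
      · by_cases h2 : Sum.inl e₂.1 ∈ W
        · rw [if_neg h1, if_pos h2] at hfe'
          exact absurd hfe' Sum.inr_ne_inl
        · rw [if_neg h1, if_neg h2] at hfe'
          exact hD.2 e₁ he₁ e₂ he₂ (Sum.inr.inj hfe')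
  have h1 : #W ≤ m / 2 := by omega
  have h2 : m / K ≤ m / 2 := Nat.div_le_div_left hK (by norm_num)
  omega

/-! ### The parametric dichotomy -/

/-- The positive weight an approximator `≢ 1` can carry: `S = ∑_{1 ≤ ℓ ≤ c/2} thr(ℓ)·(m-ℓ)!/m!`.
[cite: CavalarEtAl2026, Thm. 1 (§1; proof §3–§4) (bookkeeping)] -/
noncomputable def posSmall (c₀ ε : ℝ) (m c : ℕ) : ℝ :=
  ∑ ℓ ∈ Icc 1 (c / 2), thr c₀ (1 / 8) ε ℓ * (((m - ℓ).factorial : ℝ) / m.factorial)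

/-- The positive per-gate loss: `δP = ∑_{c/2 < ℓ ≤ c} thr(ℓ)·(m-ℓ)!/m!`.
[cite: CavalarEtAl2026, Thm. 1 (§1; proof §3–§4) (bookkeeping)] -/
noncomputable def posLost (c₀ ε : ℝ) (m c : ℕ) : ℝ :=
  ∑ ℓ ∈ Ioc (c / 2) c, thr c₀ (1 / 8) ε ℓ * (((m - ℓ).factorial : ℝ) / m.factorial)

/-- The negative per-gate gain: `δN = ε · #{A ⊆ Edge m : |A| ≤ c}`.
[cite: CavalarEtAl2026, Thm. 1 (§1; proof §3–§4) (bookkeeping)] -/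
noncomputable def negGain (ε : ℝ) (m c : ℕ) : ℝ :=
  ε * #(univ.filter fun A : Finset (Edge m) => #A ≤ c)

/-- The input of the cross-cut graph, by support. [cite: CavalarEtAl2026, Thm. 1 (§1; proof §3–§4) (bookkeeping)] -/
theorem finsetEquivFun_crossGraph (W : Finset (Vtx m)) :
    finsetEquivFun (crossGraph W) = crossInput W := rfl

/-- **The gap perfect-matching dichotomy (CKR Thm. 2.19 for `GapPM_K`, parametric).** For `m ≥ 1`,
`K ≥ 2`, `c ≥ 2`, `0 < ε ≤ 1/2`, a sunflower constant `c₀ ≥ 0` with `SunflowerBound c₀`, and the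
inputs `CrossDeficient`, `DeficientMass` of the line: every monotone circuit accepting all graphs with
a perfect matching and rejecting all `K`-deficient graphs satisfies
`1/2 ≤ size · δN` or `1 - S ≤ size · δP`. [cite: CavalarEtAl2026, Thm. 1 (§1; proof §3–§4) (bookkeeping)] -/
theorem gapPM_dichotomy {c₀ : ℝ} (hSF : SunflowerBound c₀) (hc0 : 0 ≤ c₀) (hCD : CrossDeficient)
    (hDM : DeficientMass) {K c : ℕ} (hm : 1 ≤ m) (hK : 2 ≤ K) (hc : 2 ≤ c) {ε : ℝ} (hε0 : 0 < ε)
    (hε1 : ε ≤ 1 / 2) (C : Circuit (Edge m)) (hC : C.IsOver monotoneBasis)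
    (hacc : ∀ x, perfectMatchingFn m x = true → C.eval x = true)
    (hrej : ∀ x, (∀ D : Finset (Edge m), IsMatching D → (∀ e ∈ D, x e = true) → D.card + m / K ≤ m) →
      C.eval x = false) :
    1 / 2 ≤ C.size * negGain ε m c ∨ 1 - posSmall c₀ ε m c ≤ C.size * posLost c₀ ε m c := by
  classical
  set μ : Finset (Edge m) → ℝ := crossMeasure (1 / 8) with hμdef
  have hμ0 : ∀ U, 0 ≤ μ U := fun U => crossMeasure_nonneg (by norm_num) (by norm_num) U
  have hμ1 : ∑ U, μ U = 1 := sum_crossMeasure (1 / 8)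
  have hinp : ∀ e : Edge m, prW μ (fun U : Finset (Edge m) => e ∈ U) ≤ 1 - ε := fun e =>
    (prW_crossMeasure_mem_le (m := m) (by norm_num) (by norm_num) e).trans (by linarith)
  set S := schemeW μ c ε hμ0 hc hinp with hS
  set ptP : Equiv.Perm (Fin m) → Edge m → Bool := fun σ => finsetEquivFun (permGraph σ) with hptP
  set wP : Equiv.Perm (Fin m) → ℝ := fun _ => 1 / m.factorial with hwP
  have hwP0 : ∀ σ, 0 ≤ wP σ := fun _ => by positivity
  have hmf : (0 : ℝ) < m.factorial := by exact_mod_cast Nat.factorial_pos m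
  -- per-gate positive errors
  have hlost : ∀ 𝒜 ℬ, IsApproxW μ c ε 𝒜 → IsApproxW μ c ε ℬ →
      ∑ s ∈ S.lostSup univ ptP 𝒜 ℬ, wP s ≤ posLost c₀ ε m c ∧
      ∑ s ∈ S.lostInf univ ptP 𝒜 ℬ, wP s ≤ posLost c₀ ε m c := by
    intro 𝒜 ℬ h𝒜 hℬ
    obtain ⟨hU, hI⟩ := h𝒜.card_le_of_mem_minimals_union_inter hℬ
    constructor
    · refine le_trans ?_ (sum_perm_lost_le (m := m) hSF hc0 (by norm_num) (by norm_num) hε0 hε1 hU)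
      refine sum_le_sum_of_subset_of_nonneg (fun σ hσ => ?_) fun _ _ _ => by positivity
      obtain ⟨-, h⟩ := mem_filter.1 hσ
      simp only [hS, hptP, schemeW_val_finsetEquivFun, Bool.or_eq_true, decide_eq_true_eq,
        decide_eq_false_iff_not] at h
      refine mem_filter.2 ⟨mem_univ _, ?_, h.2⟩
      rcases h.1 with h' | h'
      · exact mem_union_left _ h'
      · exact mem_union_right _ h'
    · refine le_trans ?_ (sum_perm_lost_le (m := m) hSF hc0 (by norm_num) (by norm_num) hε0 hε1 hI)
      refine sum_le_sum_of_subset_of_nonneg (fun σ hσ => ?_) fun _ _ _ => by positivity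
      obtain ⟨-, h⟩ := mem_filter.1 hσ
      simp only [hS, hptP, schemeW_val_finsetEquivFun, Bool.and_eq_true, decide_eq_true_eq,
        decide_eq_false_iff_not] at h
      exact mem_filter.2 ⟨mem_univ _, mem_inter.2 h.1, h.2⟩
  -- the approximation method
  obtain ⟨𝒜, BadP, BadN, hok, hcP, hcN, hpos, hneg⟩ :=
    exists_approxW hμ0 hμ1 hc hinp hε0.le univ ptP wP hwP0 (posLost c₀ ε m c)
      (fun a b ha hb => (hlost a b ha hb).1) (fun a b ha hb => (hlost a b ha hb).2) C hC
  -- positive accounting: every perfect matching is accepted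
  have hP : (1 : ℝ) ≤ C.size * posLost c₀ ε m c +
      ∑ _σ ∈ univ.filter (fun σ : Equiv.Perm (Fin m) => permGraph σ ∈ 𝒜), (1 / m.factorial : ℝ) := by
    have hall : ∀ σ : Equiv.Perm (Fin m), C.eval (ptP σ) = true := fun σ => by
      apply hacc
      rw [hptP]
      show perfectMatchingFn m (finsetEquivFun (permGraph σ)) = true
      rw [finsetEquivFun_permGraph]
      exact perfectMatchingFn_permInput σ
    have hsub : (univ : Finset (Equiv.Perm (Fin m))) ⊆
        BadP ∪ univ.filter fun σ : Equiv.Perm (Fin m) => permGraph σ ∈ 𝒜 := by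
      intro σ _
      by_cases hB : σ ∈ BadP
      · exact mem_union_left _ hB
      · refine mem_union_right _ (mem_filter.2 ⟨mem_univ _, ?_⟩)
        have := hpos σ (mem_univ _) hB (hall σ)
        simpa [hptP] using this
    have htot : ∑ _σ : Equiv.Perm (Fin m), (1 / m.factorial : ℝ) = 1 := by
      rw [sum_const, card_univ, Fintype.card_perm, Fintype.card_fin, nsmul_eq_mul]
      field_simp
    calc (1 : ℝ) = ∑ _σ : Equiv.Perm (Fin m), (1 / m.factorial : ℝ) := htot.symm
      _ ≤ ∑ _σ ∈ BadP ∪ univ.filter (fun σ : Equiv.Perm (Fin m) => permGraph σ ∈ 𝒜),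
            (1 / m.factorial : ℝ) :=
          sum_le_sum_of_subset_of_nonneg hsub fun _ _ _ => by positivity
      _ ≤ ∑ _σ ∈ BadP, (1 / m.factorial : ℝ) +
            ∑ _σ ∈ univ.filter (fun σ : Equiv.Perm (Fin m) => permGraph σ ∈ 𝒜),
              (1 / m.factorial : ℝ) :=
          ApproxScheme.sum_union_le_of_nonneg (fun _ => by positivity) _ _
      _ ≤ _ := by exact add_le_add hcP le_rfl
  -- negative accounting: the deficient cross-cut graphs are rejected
  have hN : (1 / 2 : ℝ) ≤ C.size * negGain ε m c + prW μ (fun U : Finset (Edge m) => U ∉ 𝒜) := by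
    have hrejW : ∀ W : Finset (Vtx m), 2 * #W ≤ m → C.eval (finsetEquivFun (crossGraph W)) = false := by
      intro W hW
      apply hrej
      intro D hD hDx
      exact hCD m K W hK hW D hD fun e he => by simpa [finsetEquivFun_crossGraph] using hDx e he
    have hsub : (univ.filter fun W : Finset (Vtx m) => 2 * #W ≤ m) ⊆
        (univ.filter fun W : Finset (Vtx m) => crossGraph W ∈ BadN) ∪
          univ.filter fun W : Finset (Vtx m) => crossGraph W ∉ 𝒜 := by
      intro W hW
      have hW := (mem_filter.1 hW).2
      rw [mem_union, mem_filter, mem_filter]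
      by_cases hB : crossGraph W ∈ BadN
      · exact Or.inl ⟨mem_univ _, hB⟩
      · refine Or.inr ⟨mem_univ _, fun h𝒜 => ?_⟩
        have := hneg (crossGraph W) hB h𝒜
        rw [hrejW W hW] at this
        exact Bool.false_ne_true this
    have h18 : (0 : ℝ) ≤ 1 / 8 := by norm_num
    have h18' : (1 : ℝ) / 8 ≤ 1 := by norm_num
    have hBadN : ∑ W ∈ univ.filter (fun W : Finset (Vtx m) => crossGraph W ∈ BadN),
        biasedWeight (1 / 8) W = ∑ U ∈ BadN, μ U := by
      rw [← prW_crossMeasure (1 / 8) (fun U => U ∈ BadN)]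
      unfold prW
      rw [filter_mem_eq_inter, univ_inter]
    have hnot𝒜 : ∑ W ∈ univ.filter (fun W : Finset (Vtx m) => crossGraph W ∉ 𝒜),
        biasedWeight (1 / 8) W = prW μ (fun U : Finset (Edge m) => U ∉ 𝒜) :=
      (prW_crossMeasure (1 / 8) (fun U => U ∉ 𝒜)).symm
    calc (1 / 2 : ℝ) ≤ ∑ W ∈ univ.filter (fun W : Finset (Vtx m) => 2 * #W ≤ m),
          biasedWeight (1 / 8) W := hDM m hm
      _ ≤ ∑ W ∈ (univ.filter fun W : Finset (Vtx m) => crossGraph W ∈ BadN) ∪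
            univ.filter (fun W : Finset (Vtx m) => crossGraph W ∉ 𝒜), biasedWeight (1 / 8) W :=
          sum_le_sum_of_subset_of_nonneg hsub fun W _ _ => biasedWeight_nonneg h18 h18' W
      _ ≤ ∑ W ∈ univ.filter (fun W : Finset (Vtx m) => crossGraph W ∈ BadN), biasedWeight (1 / 8) W +
            ∑ W ∈ univ.filter (fun W : Finset (Vtx m) => crossGraph W ∉ 𝒜), biasedWeight (1 / 8) W :=
          ApproxScheme.sum_union_le_of_nonneg (fun W => biasedWeight_nonneg h18 h18' W) _ _
      _ ≤ _ := by rw [hBadN, hnot𝒜]; exact add_le_add hcN le_rfl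
  -- dichotomy on `∅ ∈ 𝒜`
  by_cases h0 : ∅ ∈ 𝒜
  · left
    have hall : ∀ U : Finset (Edge m), U ∈ 𝒜 := fun U => hok.isUpperSet (empty_subset U) h0
    rw [prW_eq_zero fun U h => h (hall U), add_zero] at hN
    exact hN
  · right
    have h := sum_perm_mem_le (m := m) hSF hc0 (by norm_num) (by norm_num) hε0 hε1 hok h0
    have : ∑ _σ ∈ univ.filter (fun σ : Equiv.Perm (Fin m) => permGraph σ ∈ 𝒜), (1 / m.factorial : ℝ)
        ≤ posSmall c₀ ε m c := h
    linarith

end Literature.Computability.Complexity.CGRSS2026.NegLimitedGapPM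

end Part8

/-!
## Part 9 — port of `Summits/PneNP/PneNP/Theorems/NegLimitedGapPMQuasipolyOfExp.lean` (1 declarations kept)

# Route NegLimited — T5⁺ ⇒ T5: `GapPerfectMatchingExp → GapPerfectMatchingQuasipoly` 

Registered stub `stub_quasipoly_of_exp` of the skeleton line `r7-crosscut` for item T5 =
`NegLimited.GapPerfectMatchingQuasipoly` . This file DECLARES the statement `GapPerfectMatchingExp` (T5⁺, the gap-robust
exponential monotone lower bound for perfect matching — new, not in print; copied verbatim from the
cell's shared definitions file HOME/pnp-ideate-p3/turnkey-R8/NegLimitedGapPMDefs.lean into the shared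
namespace `Summit.PneNP.PneNP.Theorems.NegLimitedGapPM`; later files of the line import it from here)
and proves the routine implication to the route item: with `δ = 1/12` the exponential bound
`2^{m^{1/4}}` dominates `m^{c log m} = exp(c log² m)` for `c = 1`, eventually in `m`
(`isLittleO_log_rpow_rpow_atTop`: `log² x = o(x^{1/4})`).

(Verbatim declaration-level port — the declarations listed in the Part header count — of the Summits-side module of the PneNP
tree's NegLimited route; route / round / item bookkeeping in the text above is historical.)
-/

section Part9

namespace Literature.Computability.Complexity.CGRSS2026.NegLimitedGapPM

open _root_.Finset _root_.Filter
open Literature.Computability.Complexity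
open Literature.Computability.Complexity.PerfectMatching
open Literature.Barriers.PneNP (perfectMatchingFn)

/-- T5⁺: the gap-robust exponential perfect-matching lower bound (new theorem, not in print;
statement verbatim from the skeleton line `r7-crosscut`): for every gap `K ≥ 2` and `δ > 0`,
eventually every monotone circuit accepting all graphs with a perfect matching and rejecting all
`K`-deficient graphs has at least `2^{m^{1/3-δ}}` gates.
[cite: CavalarEtAl2026, Thm. 1 (§1; proof §3–§4) (bookkeeping)] -/
def GapPerfectMatchingExp : Prop :=
  ∀ K : ℕ, 2 ≤ K → ∀ δ : ℝ, 0 < δ → ∀ᶠ m : ℕ in atTop,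
    ∀ C : Circuit (Edge m), C.IsOver monotoneBasis →
      (∀ x, perfectMatchingFn m x = true → C.eval x = true) →
      (∀ x, (∀ D : Finset (Edge m), IsMatching D → (∀ e ∈ D, x e = true) → D.card + m / K ≤ m) →
        C.eval x = false) →
      (2 : ℝ) ^ ((m : ℝ) ^ (1 / 3 - δ)) ≤ C.size

end Literature.Computability.Complexity.CGRSS2026.NegLimitedGapPM

end Part9

/-!
## Part 10 — port of `Summits/PneNP/PneNP/Theorems/NegLimitedGapPMExp.lean` (5 declarations kept)

# Route NegLimited — T5⁺ `GapPerfectMatchingExp`: the parameter discharge 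

From the parametric dichotomy `gapPM_dichotomy` (`NegLimitedGapPMParametric.lean`) to T5⁺
`GapPerfectMatchingExp` (`gapPMExp_of`; the registered stub `stub_gapPMExp` of the skeleton line
`r7-crosscut`, item stmt-PneNP-19861, is the one-liner of `NegLimitedGapPMExpStub.lean` on top of it;
cell record HOME/pnp-ideate-p3/ROUND-7.md §4 "DISCHARGE"). Parameters, for a gap `K ≥ 2` and `δ > 0` (wlog
`δ ≤ 1/6`): `w = ⌊m^{1/3-δ/2}⌋`, closedness `c = 2w` (trim at `w`), `ε = m^{-5w}`, bias `p = 1/8`.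
Then `δN = ε·#{A : |A| ≤ 2w} ≤ (2w+1) m^{-w} ≤ 2^{-(w+1)}`, every positive term
`thr(ℓ)(m-ℓ)!/m! ≤ q^ℓ` with `q = 9216 c₀ w³ log²m / m ≤ 1/4` eventually (`w³ ≤ m^{1-3δ/2}`,
`log² m = o(m^{3δ/2})`), so `S ≤ 1/3`, `δP ≤ 4^{-w}/3`, and either branch of the dichotomy gives
`size ≥ 2^w ≥ 2^{m^{1/3-δ}}`.

(Verbatim declaration-level port — the declarations listed in the Part header count — of the Summits-side module of the PneNP
tree's NegLimited route; route / round / item bookkeeping in the text above is historical.)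
-/

section Part10

namespace Literature.Computability.Complexity.CGRSS2026.NegLimitedGapPM

open _root_.Finset _root_.Filter Literature.Computability.Complexity Literature.Computability.Complexity.PerfectMatching
  Literature.Computability.Complexity.CKR
open Literature.Barriers.PneNP (perfectMatchingFn)

/-! ### Elementary estimates -/

/-- `(m-ℓ)!/m! ≤ (2/m)^ℓ` for `2ℓ ≤ m + 2` (each of the `ℓ` factors `m, m-1, …, m-ℓ+1` is `≥ m/2`).
[cite: CavalarEtAl2026, Thm. 1 (§1; proof §3–§4) (bookkeeping)] -/
theorem factorial_div_factorial_le {m ℓ : ℕ} (hℓm : ℓ ≤ m) (h2 : 2 * ℓ ≤ m + 2) (hm : 1 ≤ m) :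
    (((m - ℓ).factorial : ℝ) / m.factorial) ≤ (2 / (m : ℝ)) ^ ℓ := by
  have hmf : (0 : ℝ) < m.factorial := by exact_mod_cast Nat.factorial_pos m
  have hmr : (0 : ℝ) < m := by exact_mod_cast hm
  have hdesc : ((m - ℓ).factorial : ℝ) * m.descFactorial ℓ = m.factorial := by
    exact_mod_cast Nat.factorial_mul_descFactorial hℓm
  have hpow : ((m + 1 - ℓ : ℕ) : ℝ) ^ ℓ ≤ m.descFactorial ℓ := by
    exact_mod_cast Nat.pow_sub_le_descFactorial m ℓ
  have h2r : (2 : ℝ) * ℓ ≤ m + 2 := by exact_mod_cast h2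
  have hhalf : (m : ℝ) / 2 ≤ ((m + 1 - ℓ : ℕ) : ℝ) := by
    rw [Nat.cast_sub (by omega)]; push_cast; linarith
  have hdpos : (0 : ℝ) < ((m : ℝ) / 2) ^ ℓ := by positivity
  have hdesc_ge : ((m : ℝ) / 2) ^ ℓ ≤ m.descFactorial ℓ :=
    (pow_le_pow_left₀ (by positivity) hhalf ℓ).trans hpow
  rw [div_le_iff₀ hmf, ← hdesc]
  have : (1 : ℝ) ≤ (2 / (m : ℝ)) ^ ℓ * m.descFactorial ℓ := by
    calc (1 : ℝ) = (2 / (m : ℝ)) ^ ℓ * ((m : ℝ) / 2) ^ ℓ := by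
          rw [← mul_pow, show (2 : ℝ) / m * (m / 2) = 1 by field_simp, one_pow]
      _ ≤ (2 / (m : ℝ)) ^ ℓ * m.descFactorial ℓ :=
          mul_le_mul_of_nonneg_left hdesc_ge (by positivity)
  have hf0 : (0 : ℝ) ≤ ((m - ℓ).factorial : ℝ) := by positivity
  nlinarith

/-- The sunflower threshold at `p = 1/8`, `ε = m^{-5w}`: `thr(ℓ) ≤ (4608 c₀ w³ log²m)^ℓ` for
`1 ≤ ℓ ≤ 2w`, `1 ≤ w`, `2w ≤ m` (`log(ℓ/ε) = log ℓ + 5w log m ≤ 6 w log m`).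
[cite: CavalarEtAl2026, Thm. 1 (§1; proof §3–§4) (bookkeeping)] -/
theorem thr_le {c₀ : ℝ} (hc0 : 0 ≤ c₀) {m w ℓ : ℕ} (hw : 1 ≤ w) (hwm : 2 * w ≤ m) (hℓ1 : 1 ≤ ℓ)
    (hℓw : ℓ ≤ 2 * w) :
    thr c₀ (1 / 8) (1 / (m : ℝ) ^ (5 * w)) ℓ ≤ (4608 * c₀ * (w : ℝ) ^ 3 * Real.log m ^ 2) ^ ℓ := by
  have hm2 : (2 : ℝ) ≤ m := by exact_mod_cast (by omega : 2 ≤ m)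
  have hm0 : (0 : ℝ) < m := by linarith
  have hℓr : (1 : ℝ) ≤ ℓ := by exact_mod_cast hℓ1
  have hwr : (1 : ℝ) ≤ w := by exact_mod_cast hw
  have hlogm : 0 ≤ Real.log m := Real.log_nonneg (by linarith)
  have hlog2 : Real.log 2 ≤ Real.log m := Real.log_le_log two_pos hm2
  have hlog2' : (0 : ℝ) < Real.log 2 := Real.log_pos one_lt_two
  -- `log(ℓ/ε) = log ℓ + 5w log m ≤ 6 w log m`
  have hL : Real.log (ℓ / (1 / (m : ℝ) ^ (5 * w))) ≤ 6 * w * Real.log m := by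
    rw [div_div_eq_mul_div, div_one, Real.log_mul (by positivity) (by positivity), Real.log_pow]
    have hℓm : Real.log ℓ ≤ Real.log m :=
      Real.log_le_log (by positivity) (by exact_mod_cast (by omega : ℓ ≤ m))
    have : Real.log m ≤ w * Real.log m := le_mul_of_one_le_left hlogm hwr
    push_cast
    nlinarith
  have hL0 : 0 ≤ Real.log (ℓ / (1 / (m : ℝ) ^ (5 * w))) := by
    apply Real.log_nonneg
    rw [le_div_iff₀ (by positivity)]
    have : (1 : ℝ) / (m : ℝ) ^ (5 * w) ≤ 1 := by
      rw [div_le_one (by positivity)]; exact one_le_pow₀ (by linarith)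
    linarith
  unfold thr
  refine pow_le_pow_left₀ (by positivity) ?_ ℓ
  have hℓ2w : (ℓ : ℝ) ≤ 2 * w := by exact_mod_cast hℓw
  have hsq : Real.log (ℓ / (1 / (m : ℝ) ^ (5 * w))) ^ 2 ≤ (6 * w * Real.log m) ^ 2 :=
    pow_le_pow_left₀ hL0 hL 2
  calc c₀ * ℓ * Real.log (ℓ / (1 / (m : ℝ) ^ (5 * w))) ^ 2 / (1 / 8) ^ 2
      = 64 * (c₀ * ℓ * Real.log (ℓ / (1 / (m : ℝ) ^ (5 * w))) ^ 2) := by norm_num; ring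
    _ ≤ 64 * (c₀ * (2 * w) * (6 * w * Real.log m) ^ 2) := by
        gcongr
    _ = 4608 * c₀ * (w : ℝ) ^ 3 * Real.log m ^ 2 := by ring

/-- The negative gain at `ε = m^{-5w}`, `c = 2w`: `δN ≤ (2w+1) m^{4w} m^{-5w} ≤ 2^{-(w+1)}` for `m ≥ 16`.
[cite: CavalarEtAl2026, Thm. 1 (§1; proof §3–§4) (bookkeeping)] -/
theorem negGain_le {m w : ℕ} (hw : 1 ≤ w) (hm : 16 ≤ m) :
    negGain (1 / (m : ℝ) ^ (5 * w)) m (2 * w) ≤ 1 / 2 ^ (w + 1) := by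
  unfold negGain
  have hm0 : (0 : ℝ) < m := by exact_mod_cast (by omega : 0 < m)
  have hcardE : Fintype.card (Edge m) = m * m := by simp [Fintype.card_prod]
  have hcnt : (#(univ.filter fun A : Finset (Edge m) => #A ≤ 2 * w) : ℝ) ≤ (2 * w + 1) * ((m : ℝ) * m) ^ (2 * w) := by
    have h := card_filter_card_le_le (α := Edge m) (by rw [hcardE]; positivity) (2 * w)
    rw [hcardE] at h
    exact_mod_cast h
  -- (2w+1) m^{4w} / m^{5w} = (2w+1)/m^w ≤ 2^{-(w+1)}
  have hkeyN : ∀ k, 1 ≤ k → (2 * k + 1) * 2 ^ (k + 1) ≤ m ^ k := by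
    intro k hk
    induction k, hk using Nat.le_induction with
    | base => simp; omega
    | succ k hk ih =>
      calc (2 * (k + 1) + 1) * 2 ^ (k + 1 + 1) = 2 * (2 * k + 3) * 2 ^ (k + 1) := by ring
        _ ≤ 16 * (2 * k + 1) * 2 ^ (k + 1) := Nat.mul_le_mul_right _ (by omega)
        _ = 16 * ((2 * k + 1) * 2 ^ (k + 1)) := by ring
        _ ≤ m * m ^ k := Nat.mul_le_mul hm ih
        _ = m ^ (k + 1) := by ring
  have hkey : ((2 * w + 1 : ℕ) : ℝ) * 2 ^ (w + 1) ≤ (m : ℝ) ^ w := by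
    exact_mod_cast hkeyN w hw
  have hpow : ((m : ℝ) * m) ^ (2 * w) * (m : ℝ) ^ w = (m : ℝ) ^ (5 * w) := by
    rw [mul_pow, ← pow_add, ← pow_add]; congr 1; ring
  have hratio : ((m : ℝ) * m) ^ (2 * w) / (m : ℝ) ^ (5 * w) = 1 / (m : ℝ) ^ w := by
    rw [div_eq_div_iff (by positivity) (by positivity), one_mul, hpow]
  calc 1 / (m : ℝ) ^ (5 * w) * #(univ.filter fun A : Finset (Edge m) => #A ≤ 2 * w)
      ≤ 1 / (m : ℝ) ^ (5 * w) * ((2 * w + 1) * ((m : ℝ) * m) ^ (2 * w)) :=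
        mul_le_mul_of_nonneg_left hcnt (by positivity)
    _ = (2 * w + 1) * (((m : ℝ) * m) ^ (2 * w) / (m : ℝ) ^ (5 * w)) := by ring
    _ = (2 * w + 1) / (m : ℝ) ^ w := by rw [hratio]; ring
    _ ≤ 1 / 2 ^ (w + 1) := by
        rw [div_le_div_iff₀ (by positivity) (by positivity), one_mul]
        exact_mod_cast hkey

/-- Both positive sums are geometric: with `q ≤ 1/4` bounding every term `thr(ℓ)(m-ℓ)!/m! ≤ q^ℓ`
(`1 ≤ ℓ ≤ 2w`), `S ≤ 1/3` and `δP ≤ q^{w+1}·4/3 ≤ (1/3)·4^{-w}`.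
[cite: CavalarEtAl2026, Thm. 1 (§1; proof §3–§4) (bookkeeping)] -/
theorem posSmall_posLost_le {c₀ : ℝ} (hc0 : 0 ≤ c₀) {m w : ℕ} (hw : 1 ≤ w) (hwm : 4 * w ≤ m)
    (hq : 9216 * c₀ * (w : ℝ) ^ 3 * Real.log m ^ 2 / m ≤ 1 / 4) :
    posSmall c₀ (1 / (m : ℝ) ^ (5 * w)) m (2 * w) ≤ 1 / 3 ∧
      posLost c₀ (1 / (m : ℝ) ^ (5 * w)) m (2 * w) ≤ 1 / 3 * (1 / 4) ^ w := by
  set q : ℝ := 9216 * c₀ * (w : ℝ) ^ 3 * Real.log m ^ 2 / m with hqdef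
  have hm1 : 1 ≤ m := by omega
  have hm0 : (0 : ℝ) < m := by exact_mod_cast (by omega : 0 < m)
  have hq0 : 0 ≤ q := by
    have : 0 ≤ Real.log m ^ 2 := sq_nonneg _
    positivity
  have hterm : ∀ ℓ ∈ Icc 1 (2 * w),
      thr c₀ (1 / 8) (1 / (m : ℝ) ^ (5 * w)) ℓ * (((m - ℓ).factorial : ℝ) / m.factorial) ≤ q ^ ℓ := by
    intro ℓ hℓ
    rw [mem_Icc] at hℓ
    have h1 := thr_le (m := m) hc0 hw (by omega) hℓ.1 hℓ.2
    have h2 := factorial_div_factorial_le (m := m) (ℓ := ℓ) (by omega) (by omega) hm1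
    have hthr0 : 0 ≤ thr c₀ (1 / 8) (1 / (m : ℝ) ^ (5 * w)) ℓ := by
      unfold thr
      have : 0 ≤ Real.log (ℓ / (1 / (m : ℝ) ^ (5 * w))) ^ 2 := sq_nonneg _
      positivity
    calc thr c₀ (1 / 8) (1 / (m : ℝ) ^ (5 * w)) ℓ * (((m - ℓ).factorial : ℝ) / m.factorial)
        ≤ (4608 * c₀ * (w : ℝ) ^ 3 * Real.log m ^ 2) ^ ℓ * (2 / (m : ℝ)) ^ ℓ :=
          mul_le_mul h1 h2 (by positivity) (by positivity)
      _ = q ^ ℓ := by rw [← mul_pow, hqdef]; congr 1; field_simp; ring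
  have hq1 : q < 1 := by linarith
  constructor
  · unfold posSmall
    have hIcc : Icc 1 (2 * w / 2) = Ico 1 (w + 1) := by
      ext ℓ; simp only [mem_Icc, mem_Ico]; omega
    calc ∑ ℓ ∈ Icc 1 (2 * w / 2), thr c₀ (1 / 8) (1 / (m : ℝ) ^ (5 * w)) ℓ *
          (((m - ℓ).factorial : ℝ) / m.factorial)
        ≤ ∑ ℓ ∈ Icc 1 (2 * w / 2), q ^ ℓ :=
          sum_le_sum fun ℓ hℓ => hterm ℓ (by rw [mem_Icc] at hℓ ⊢; omega)
      _ = ∑ ℓ ∈ Ico 1 (w + 1), q ^ ℓ := by rw [hIcc]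
      _ ≤ q ^ 1 / (1 - q) := geom_sum_Ico_le_of_lt_one hq0 hq1
      _ ≤ 1 / 3 := by
          rw [pow_one, div_le_iff₀ (by linarith)]; linarith
  · unfold posLost
    have hIoc : Ioc (2 * w / 2) (2 * w) = Ico (w + 1) (2 * w + 1) := by
      ext ℓ; simp only [mem_Ioc, mem_Ico]; omega
    calc ∑ ℓ ∈ Ioc (2 * w / 2) (2 * w), thr c₀ (1 / 8) (1 / (m : ℝ) ^ (5 * w)) ℓ *
          (((m - ℓ).factorial : ℝ) / m.factorial)
        ≤ ∑ ℓ ∈ Ioc (2 * w / 2) (2 * w), q ^ ℓ :=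
          sum_le_sum fun ℓ hℓ => hterm ℓ (by rw [mem_Ioc] at hℓ; rw [mem_Icc]; omega)
      _ = ∑ ℓ ∈ Ico (w + 1) (2 * w + 1), q ^ ℓ := by rw [hIoc]
      _ ≤ q ^ (w + 1) / (1 - q) := geom_sum_Ico_le_of_lt_one hq0 hq1
      _ ≤ (1 / 4) ^ (w + 1) / (1 - q) :=
          div_le_div_of_nonneg_right (pow_le_pow_left₀ hq0 hq (w + 1)) (by linarith)
      _ ≤ (1 / 4) ^ (w + 1) / (3 / 4) :=
          div_le_div_of_nonneg_left (by positivity) (by norm_num) (by linarith)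
      _ = 1 / 3 * (1 / 4) ^ w := by rw [pow_succ]; ring

/-! ### The discharge -/

/-- **T5⁺ from the inputs of the line**: `SunflowerBound c₀` (the biased Matching Sunflower Lemma with
its constant), `CrossDeficient`, `DeficientMass` ⟹ `GapPerfectMatchingExp`.
[cite: CavalarEtAl2026, Thm. 1 (§1; proof §3–§4) (bookkeeping)] -/
theorem gapPMExp_of {c₀ : ℝ} (hSF : SunflowerBound c₀) (hc0 : 0 < c₀) (hCD : CrossDeficient)
    (hDM : DeficientMass) : GapPerfectMatchingExp := by
  intro K hK δ hδ
  -- wlog `δ ≤ 1/6`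
  set δ₀ : ℝ := min δ (1 / 6) with hδ₀def
  have hδ₀ : 0 < δ₀ := lt_min hδ (by norm_num)
  have hδ₀6 : δ₀ ≤ 1 / 6 := min_le_right _ _
  have hδ₀δ : δ₀ ≤ δ := min_le_left _ _
  set a : ℝ := 1 / 3 - δ₀ / 2 with hadef
  have ha4 : 1 / 4 ≤ a := by rw [hadef]; linarith
  have ha3 : a ≤ 1 / 3 := by rw [hadef]; linarith
  -- eventual estimates in `m`
  have E4 : ∀ᶠ m : ℕ in atTop, 9216 * c₀ * Real.log m ^ 2 ≤ 1 / 4 * (m : ℝ) ^ (3 * δ₀ / 2) := by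
    have hlo := (isLittleO_log_rpow_rpow_atTop (2 : ℝ) (by positivity : (0 : ℝ) < 3 * δ₀ / 2)).bound
      (show (0 : ℝ) < 1 / 4 / (9216 * c₀) by positivity)
    filter_upwards [tendsto_natCast_atTop_atTop.eventually hlo, eventually_ge_atTop 1] with m hb hm1
    have hm1r : (1 : ℝ) ≤ m := by exact_mod_cast hm1
    rw [Real.norm_of_nonneg (Real.rpow_nonneg (Real.log_nonneg hm1r) _),
      Real.norm_of_nonneg (Real.rpow_nonneg (by linarith) _), Real.rpow_two] at hb
    have hc' : (0 : ℝ) < 9216 * c₀ := by positivity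
    calc 9216 * c₀ * Real.log m ^ 2 ≤ 9216 * c₀ * (1 / 4 / (9216 * c₀) * (m : ℝ) ^ (3 * δ₀ / 2)) :=
          mul_le_mul_of_nonneg_left hb hc'.le
      _ = 1 / 4 * (m : ℝ) ^ (3 * δ₀ / 2) := by field_simp
  have E5 : ∀ᶠ m : ℕ in atTop, (2 : ℝ) ≤ (m : ℝ) ^ (δ₀ / 2) :=
    tendsto_natCast_atTop_atTop.eventually ((tendsto_rpow_atTop (by positivity)).eventually_ge_atTop 2)
  filter_upwards [eventually_ge_atTop 16, E4, E5] with m hm16 hE4 hE5 C hC hacc hrej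
  -- the parameters
  have hm1 : 1 ≤ m := by omega
  have hm0 : (0 : ℝ) < m := by exact_mod_cast (by omega : 0 < m)
  have hm1r : (1 : ℝ) ≤ m := by exact_mod_cast hm1
  have h16r : (16 : ℝ) ≤ m := by exact_mod_cast hm16
  set w : ℕ := ⌊(m : ℝ) ^ a⌋₊ with hwdef
  have hma1 : (1 : ℝ) ≤ (m : ℝ) ^ a := Real.one_le_rpow hm1r (by linarith)
  have hw1 : 1 ≤ w := (Nat.one_le_floor_iff _).2 hma1
  have hwle : (w : ℝ) ≤ (m : ℝ) ^ a := Nat.floor_le (by positivity)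
  have hwlt : (m : ℝ) ^ a < w + 1 := Nat.lt_floor_add_one _
  -- `4w ≤ m`: `w ≤ m^{1/3}` and `4 m^{1/3} ≤ m` for `m ≥ 64`; here via `w^3 ≤ m` and `w ≥ ...`; we use
  -- `w ≤ m^a ≤ m^{1/3}` and `64 ≤ m`? only `16 ≤ m` is available, so argue `(4w)^3 = 64 w^3 ≤ 64 m^{3a}`:
  have hw3 : (w : ℝ) ^ 3 ≤ (m : ℝ) ^ (3 * a) := by
    calc (w : ℝ) ^ 3 ≤ ((m : ℝ) ^ a) ^ 3 := pow_le_pow_left₀ (by positivity) hwle 3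
      _ = (m : ℝ) ^ (3 * a) := by
          rw [← Real.rpow_natCast, ← Real.rpow_mul hm0.le]; norm_num; ring_nf
  have h4w : 4 * w ≤ m := by
    -- `w ≤ m^{1/3}` and `m^{1/3} · 4 ≤ m^{1/3} · m^{2/3}` as `m^{2/3} ≥ 16^{2/3} ≥ 4`
    have h13 : (w : ℝ) ≤ (m : ℝ) ^ (1 / 3 : ℝ) :=
      hwle.trans (Real.rpow_le_rpow_of_exponent_le hm1r ha3)
    have h23 : (4 : ℝ) ≤ (m : ℝ) ^ (2 / 3 : ℝ) := by
      calc (4 : ℝ) = (8 : ℝ) ^ (2 / 3 : ℝ) := by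
            rw [show (8 : ℝ) = 2 ^ (3 : ℝ) by norm_num, ← Real.rpow_mul (by norm_num)]; norm_num
        _ ≤ (m : ℝ) ^ (2 / 3 : ℝ) := Real.rpow_le_rpow (by norm_num) (by linarith) (by norm_num)
    have : (4 : ℝ) * w ≤ m := by
      calc (4 : ℝ) * w ≤ (m : ℝ) ^ (2 / 3 : ℝ) * (m : ℝ) ^ (1 / 3 : ℝ) :=
            mul_le_mul h23 h13 (by positivity) (by positivity)
        _ = m := by rw [← Real.rpow_add hm0]; norm_num
    exact_mod_cast this
  -- `q ≤ 1/4`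
  have hq : 9216 * c₀ * (w : ℝ) ^ 3 * Real.log m ^ 2 / m ≤ 1 / 4 := by
    rw [div_le_iff₀ hm0]
    have h3a : (m : ℝ) ^ (3 * a) * (m : ℝ) ^ (3 * δ₀ / 2) = m := by
      rw [← Real.rpow_add hm0, hadef]; ring_nf; exact Real.rpow_one _
    have hlog0 : 0 ≤ Real.log m ^ 2 := sq_nonneg _
    calc 9216 * c₀ * (w : ℝ) ^ 3 * Real.log m ^ 2 = (9216 * c₀ * Real.log m ^ 2) * (w : ℝ) ^ 3 := by ring
      _ ≤ (1 / 4 * (m : ℝ) ^ (3 * δ₀ / 2)) * (m : ℝ) ^ (3 * a) :=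
          mul_le_mul hE4 hw3 (by positivity) (by positivity)
      _ = 1 / 4 * m := by rw [mul_assoc, mul_comm ((m : ℝ) ^ _), h3a]
  -- the dichotomy at `c = 2w`, `ε = m^{-5w}`
  set ε : ℝ := 1 / (m : ℝ) ^ (5 * w) with hεdef
  have hε0 : 0 < ε := by positivity
  have hε1 : ε ≤ 1 / 2 := by
    rw [hεdef, div_le_div_iff₀ (by positivity) (by norm_num), one_mul]
    calc (2 : ℝ) ≤ m := by linarith
      _ = (m : ℝ) ^ 1 := (pow_one _).symm
      _ ≤ (m : ℝ) ^ (5 * w) := pow_le_pow_right₀ hm1r (by omega)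
      _ = 1 * (m : ℝ) ^ (5 * w) := (one_mul _).symm
  have hdich := gapPM_dichotomy (m := m) hSF hc0.le hCD hDM hm1 hK (by omega : 2 ≤ 2 * w) hε0 hε1
    C hC hacc hrej
  obtain ⟨hS, hP⟩ := posSmall_posLost_le hc0.le hw1 h4w hq
  have hN := negGain_le (m := m) hw1 hm16
  -- either branch gives `2^w ≤ size`
  have hsize : (2 : ℝ) ^ w ≤ C.size := by
    have h2w : (0 : ℝ) < 2 ^ w := by positivity
    rcases hdich with h | h
    · -- `1/2 ≤ size · δN ≤ size · 2^{-(w+1)}`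
      have h1 : (1 : ℝ) / 2 ≤ C.size * (1 / 2 ^ (w + 1)) :=
        h.trans (mul_le_mul_of_nonneg_left hN (Nat.cast_nonneg _))
      rw [pow_succ] at h1
      have := mul_le_mul_of_nonneg_right h1 (by positivity : (0 : ℝ) ≤ 2 ^ w * 2)
      field_simp at this
      nlinarith
    · -- `2/3 ≤ 1 - S ≤ size · δP ≤ size · (1/3) 4^{-w}`
      have h1 : (2 : ℝ) / 3 ≤ C.size * (1 / 3 * (1 / 4) ^ w) := by
        have := h.trans (mul_le_mul_of_nonneg_left hP (Nat.cast_nonneg _))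
        linarith
      have h4 : (1 / 4 : ℝ) ^ w * 4 ^ w = 1 := by rw [← mul_pow]; norm_num
      have h24 : (2 : ℝ) ^ w ≤ 4 ^ w := pow_le_pow_left₀ (by norm_num) (by norm_num) w
      have := mul_le_mul_of_nonneg_right h1 (by positivity : (0 : ℝ) ≤ 3 * 4 ^ w)
      have h5 : C.size * (1 / 3 * (1 / 4 : ℝ) ^ w) * (3 * 4 ^ w) = C.size := by
        rw [show C.size * (1 / 3 * (1 / 4 : ℝ) ^ w) * (3 * 4 ^ w)
          = C.size * ((1 / 4 : ℝ) ^ w * 4 ^ w) by ring, h4, mul_one]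
      rw [h5] at this
      nlinarith
  -- and `2^{m^{1/3-δ}} ≤ 2^w`
  refine le_trans ?_ hsize
  have hexp : (m : ℝ) ^ (1 / 3 - δ : ℝ) ≤ w := by
    -- `m^{1/3-δ} ≤ m^{1/3-δ₀} = m^{a - δ₀/2}` and `2 m^{a-δ₀/2} ≤ m^a < w + 1`, `m^{a-δ₀/2} ≥ 1`
    have h1 : (m : ℝ) ^ (1 / 3 - δ : ℝ) ≤ (m : ℝ) ^ (a - δ₀ / 2) :=
      Real.rpow_le_rpow_of_exponent_le hm1r (by rw [hadef]; linarith)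
    have h2 : 2 * (m : ℝ) ^ (a - δ₀ / 2) ≤ (m : ℝ) ^ a := by
      calc 2 * (m : ℝ) ^ (a - δ₀ / 2) ≤ (m : ℝ) ^ (δ₀ / 2) * (m : ℝ) ^ (a - δ₀ / 2) :=
            mul_le_mul_of_nonneg_right hE5 (by positivity)
        _ = (m : ℝ) ^ a := by rw [← Real.rpow_add hm0]; ring_nf
    have h3 : (1 : ℝ) ≤ (m : ℝ) ^ (a - δ₀ / 2) := Real.one_le_rpow hm1r (by rw [hadef]; linarith)
    linarith
  calc (2 : ℝ) ^ ((m : ℝ) ^ (1 / 3 - δ : ℝ)) ≤ (2 : ℝ) ^ (w : ℝ) :=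
        Real.rpow_le_rpow_of_exponent_le one_le_two hexp
    _ = (2 : ℝ) ^ w := Real.rpow_natCast 2 w

end Literature.Computability.Complexity.CGRSS2026.NegLimitedGapPM

end Part10

/-!
## Part 11 — port of `Summits/PneNP/PneNP/Theorems/NegLimitedGapPerfectMatchingQuasipoly.lean` (1 declarations kept)

# Route NegLimited — T5⁺ `GapPerfectMatchingExp` and item T5 `GapPerfectMatchingQuasipoly` PROVED 

Assembly of the line `r7-crosscut` of item stmt-PneNP-19861 (cell pnp-ideate, HOME/pnp-ideate-p3/ROUND-7.md,
Skeleton-R7-crosscut-v3.lean): the biased Matching Sunflower Lemma (`biasedMatchingSunflower_holds`,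
`NegLimitedBiasedMatchingSunflower.lean`), the deficiency of small cross-cut graphs (`crossDeficient_holds`)
and their mass (`deficientMass_holds`) feed the `μ`-closure engine run `gapPMExp_of`
(`NegLimitedGapPMExp.lean`), giving

* `gapPerfectMatchingExp_holds : GapPerfectMatchingExp` — **T5⁺** (new theorem, not in print): for every gap
  `K ≥ 2` and `δ > 0`, eventually every monotone circuit accepting all bipartite graphs on `m + m` vertices
  with a perfect matching and rejecting all `K`-deficient graphs has at least `2^{m^{1/3-δ}}` gates;
* `gapPerfectMatchingQuasipoly_holds : NegLimited.GapPerfectMatchingQuasipoly` — the route item **T5**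
   BY NAME, via `quasipoly_of_exp_holds` (`NegLimitedGapPMQuasipolyOfExp.lean`).

The registered stub `stub_gapPMExp` (whose signature also carries `HeteroDomination`, unused) is the
one-liner of `NegLimitedGapPMExpStub.lean`. No hypothesis of the paper kind remains: every input is a
theorem of the tree (robust sunflower theorem `robust_sunflower_spreadConst`, CKR closure calculus,
Razborov's approximation method `ApproxScheme.exists_approx_circuit`).

(Verbatim declaration-level port — the declarations listed in the Part header count — of the Summits-side module of the PneNP
tree's NegLimited route; route / round / item bookkeeping in the text above is historical.)
-/

section Part11

namespace Literature.Computability.Complexity.CGRSS2026.NegLimitedGapPM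

/-- **T5⁺ proved**: the gap-robust exponential monotone lower bound for bipartite perfect matching.
[cite: CavalarEtAl2026, Thm. 1 (§1; proof §3–§4) (bookkeeping)] -/
theorem gapPerfectMatchingExp_holds : GapPerfectMatchingExp := by
  obtain ⟨c₀, hc₀, hSF⟩ := exists_sunflowerBound biasedMatchingSunflower_holds
  exact gapPMExp_of hSF hc₀ crossDeficient_holds deficientMass_holds

end Literature.Computability.Complexity.CGRSS2026.NegLimitedGapPM

end Part11

/-!
## Part 12 — port of `Summits/PneNP/PneNP/Theorems/NegLimitedGapPMCorollaries.lean` (3 declarations kept)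

# Route NegLimited — corollaries of T5⁺ `GapPerfectMatchingExp` 

Two routine consequences of the gap-robust exponential perfect-matching lower bound T5⁺
(`GapPerfectMatchingExp`, declared in `NegLimitedGapPMQuasipolyOfExp.lean`; item T5 =
`NegLimited.GapPerfectMatchingQuasipoly`, stmt-PneNP-19861; cell record HOME/pnp-ideate-p3/ROUND-7.md
§2 (R7-S2, R7-S4), `Sketch-R7.lean` §D, `turnkey-R7/add_items.json`):

* `gapExp_implies_thm1` — **R7-S2**: T5⁺ implies CGRSS Theorem 1 as vendored in the tree, the named
  fact `Literature.Computability.Complexity.CavalarEtAl2026_perfectMatching`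
  (`2^{n^{1/3-δ}} ≤ circuitSizeOver monotoneBasis (perfectMatchingFn n)` eventually): a smallest
  monotone circuit for `f_n` exists (`exists_monotone_circuit_perfectMatchingFn`,
  `exists_circuit_size_eq_circuitSizeOver`), accepts the graphs with a perfect matching and rejects
  every `2`-deficient graph once `n ≥ 2` (`perfectMatchingFn_eq_false_of_deficient`).  Landing
  T5⁺ therefore turns the named fact into a theorem of the tree.
* `GapPMProtocolDepthPoly`, `gapExp_implies_protocolDepthPoly` — **R7-S4**, the Karchmer–Wigderson
  corollary (statement = `turnkey-R7/add_items.json` item `GapPMProtocolDepthPoly`, token-for-token):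
  every deterministic protocol for the gapped Raz–Wigderson game `GPA_K` (Alice holds a graph with a
  perfect matching, Bob a `K`-deficient graph, they must name an edge of Alice's graph missing from
  Bob's) has depth `≥ m^{1/3-δ}` eventually, because a protocol of depth `D` correct on the rectangle
  `PM × Deficient_K` yields a monotone formula with `≤ 2^D - 1` gates separating the two sides
  (`KWTree.exists_formula_of_rectangle`), to which T5⁺ applies.

Nothing here is asserted without proof; both results are implications from T5⁺ (hypothesis), to be
discharged by the registered stub `stub_gapPMExp` of the skeleton.

(Verbatim declaration-level port — the declarations listed in the Part header count — of the Summits-side module of the PneNP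
tree's NegLimited route; route / round / item bookkeeping in the text above is historical.)
-/

section Part12

namespace Literature.Computability.Complexity.CGRSS2026.NegLimitedGapPM

open _root_.Finset _root_.Filter
open Literature.Computability.Complexity
open Literature.Computability.Complexity.PerfectMatching
open Literature.Barriers.PneNP (perfectMatchingFn perfectMatchingFn_eq_true_iff perfectMatchingFn_permInput exists_monotone_circuit_perfectMatchingFn)

variable {m : ℕ}

/-! ### Deficient graphs have no perfect matching -/

/-- The perfect matching of a permutation has `m` edges.
[cite: CavalarEtAl2026, Thm. 1 (§1; proof §3–§4) (bookkeeping)] -/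
theorem card_permGraph (σ : Equiv.Perm (Fin m)) : #(permGraph σ) = m := by
  have h : permGraph σ = (univ : Finset (Fin m)).map
      ⟨fun i => (i, σ i), fun i j hij => (Prod.mk.inj hij).1⟩ := by
    ext e
    rw [mem_permGraph, Finset.mem_map]
    constructor
    · intro he
      exact ⟨e.1, mem_univ _, Prod.ext rfl he⟩
    · rintro ⟨i, -, rfl⟩
      rfl
  rw [h, card_map, card_univ, Fintype.card_fin]

/-- **A `K`-deficient graph with `K ≤ m`, `K ≥ 1`, has no perfect matching**: a perfect matching is a
matching `D ⊆ x` with `m` edges, and `m + m/K ≤ m` forces `m < K`.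
[cite: CavalarEtAl2026, Thm. 1 (§1; proof §3–§4) (bookkeeping)] -/
theorem perfectMatchingFn_eq_false_of_deficient {K : ℕ} (hK : 1 ≤ K) (hKm : K ≤ m) {x : Edge m → Bool}
    (hx : ∀ D : Finset (Edge m), IsMatching D → (∀ e ∈ D, x e = true) → D.card + m / K ≤ m) :
    perfectMatchingFn m x = false := by
  rw [Bool.eq_false_iff]
  intro h
  obtain ⟨σ, hσ⟩ := (perfectMatchingFn_eq_true_iff m x).1 h
  have hD := hx (permGraph σ) (isMatching_permGraph σ) fun e he => by
    rw [mem_permGraph] at he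
    have hee : e = (e.1, σ e.1) := Prod.ext rfl he.symm
    rw [hee]
    exact hσ e.1
  rw [card_permGraph] at hD
  have h0 : m / K = 0 := by
    have h' : m + m / K ≤ m + 0 := by rwa [Nat.add_zero]
    exact Nat.le_zero.1 (Nat.le_of_add_le_add_left h')
  have hpos : 0 < m / K := Nat.div_pos hKm hK
  rw [h0] at hpos
  exact lt_irrefl 0 hpos

/-! ### R7-S2: T5⁺ implies CGRSS Theorem 1 -/

/-- **R7-S2**: the gap-robust bound T5⁺ implies CGRSS Theorem 1 in the vendored form
`CavalarEtAl2026_perfectMatching` (`2^{n^{1/3-δ}} ≤ circuitSizeOver monotoneBasis (perfectMatchingFn n)`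
for all large `n`): apply T5⁺ with `K = 2` to a smallest monotone circuit computing `f_n`, which
accepts every graph with a perfect matching and, for `n ≥ 2`, rejects every `2`-deficient graph.
[cite: CavalarEtAl2026, Thm. 1 (§1; proof §3–§4) (bookkeeping)] -/
theorem gapExp_implies_thm1 : GapPerfectMatchingExp → CavalarEtAl2026_perfectMatching := by
  intro h δ hδ
  filter_upwards [h 2 le_rfl δ hδ, eventually_ge_atTop 2] with n hn hn2
  obtain ⟨C, hCB, hCf, hsize⟩ := exists_circuit_size_eq_circuitSizeOver
    (exists_monotone_circuit_perfectMatchingFn (m := n) (by omega))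
  rw [← hsize]
  refine hn C hCB (fun x hx => by rw [hCf x]; exact hx) fun x hx => ?_
  rw [hCf x]
  exact perfectMatchingFn_eq_false_of_deficient (by norm_num) hn2 hx

end Literature.Computability.Complexity.CGRSS2026.NegLimitedGapPM

end Part12

/-! ## Part 13 — the EXACT discharge `CavalarEtAl2026_perfectMatching_holds` -/

namespace Literature.Computability.Complexity

open CGRSS2026 CGRSS2026.NegLimitedGapPM

/-- **CGRSS Theorem 1 — the named fact `CavalarEtAl2026_perfectMatching` HOLDS** (`MatchingSunflowers.lean`; Cavalar–Göös–Riazanov–Sofronova–Sokolov,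
STOC 2026, arXiv:2507.16105, Thm. 1: for every `δ > 0`, eventually `2^{n^{1/3−δ}} ≤` the monotone circuit size of the perfect-matching function of
`K_{n,n}`).  EXACT-name discharge through the gap-robust engine (`NegLimitedGapPM.gapPerfectMatchingExp_holds`: biased matching sunflowers +
the CKR closure calculus on the `1/8`-biased cross-cut measure) and `NegLimitedGapPM.gapExp_implies_thm1`.  Literature-side twin of the Summits-side
`Summit.PneNP.PneNP.Theorems.NegLimitedGapPM.CavalarEtAl2026_perfectMatching_holds`.  A MONOTONE lower bound; nothing about P vs NP.
[cite: CavalarEtAl2026, Thm. 1 (§1; proof §3–§4)] -/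
theorem CavalarEtAl2026_perfectMatching_holds : CavalarEtAl2026_perfectMatching :=
  gapExp_implies_thm1 gapPerfectMatchingExp_holds

/-- The `2^{n^{Ω(1)}}` shape of CGRSS Theorem 1, unconditionally (`c = 1/6`). [cite: CavalarEtAl2026, Thm. 1] -/
theorem two_pow_rpow_le_circuitSizeOver_perfectMatchingFn :
    ∃ c : ℝ, 0 < c ∧ ∀ᶠ n : ℕ in Filter.atTop,
      (2 : ℝ) ^ ((n : ℝ) ^ c) ≤ circuitSizeOver monotoneBasis (Literature.Barriers.PneNP.perfectMatchingFn n) :=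
  CavalarEtAl2026_perfectMatching_holds.two_pow_rpow

end Literature.Computability.Complexity

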